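import Literature.NumberTheory.LFunctions.CertifiedDirichletLTuringMethod
import Literature.NumberTheory.LFunctions.DirichletLZeroCountingTwoSided
import HarnessLib

/-!
# Turing's method for Dirichlet `L`-functions: the zero-counting identity (Rumely 1993, (3)) PROVED

Topic `Literature/NumberTheory/LFunctions`; namespace `Literature.NumberTheory.LFunctions`
(helpers in `Literature.NumberTheory.LFunctions.TuringDirichlet`). Proofs-only companion (no
definitions, no named facts — D-0026) of `CertifiedDirichletLTuringMethod.lean`, which DEFINES
Rumely's branch-free phase `θ(t, χ)` (`lfunctionTheta χ t = ∫₀ᵗ θ'`,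
`θ'(u) = Re ψ((½ + a_χ + iu)/2)/2 + ½ log(q/π)`), the ray form of
`S(t, χ) = −(1/π) ∫_{1/2}^∞ Im (L'/L)(σ + it, χ) dσ` (`lfunctionArgS`; Booker 2006 (4–1), Platt 2016
Thm. 3.2, Rumely 1993 §4) and the window count `N(t, χ)|_{t₁}^{t₂}` (`lfunctionZeroCountIoc`), and
vendors **Rumely 1993, §4 eq. (3)** — the argument principle for the completed `L`-function in the form
`N(t, χ)|_{t₁}^{t₂} = (1/π) θ(t, χ)|_{t₁}^{t₂} + S(t, χ)|_{t₁}^{t₂}` (`t₁ < t₂` ordinates of no zero) —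
as the named fact `rumely1993_eq3`, the zero-counting step on which the certified GRH computations
of the tree (`platt2016_theorem71/72`, `rumely1993_theorem4`, `bmor2021_lemma61a`) rest.

**This file DISCHARGES that fact** (`rumely1993_eq3_holds`). The work is already in the tree: the
cell `rh-explicit` proved Montgomery–Vaughan's Theorem 14.5 for a primitive `χ` mod `q ≠ 1` in
Backlund's two-height form (`DirichletLZeroCounting.lean`, `DirichletTheta.pi_mul_finsum_zeroOrder_eq`:
`π·Σ_{t₁<γ<t₂} m(ρ) = [θ_κ(t) + (t/2) log q + π S(t, χ)]_{t₁}^{t₂}`, by the tree's argument principle on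
`[−1, 2] × [t₁, t₂]` for `ξ(s, χ)` folded by `ξ(1 − s̄, χ) = ε(χ)·conj ξ(s, χ)`), with ITS OWN
branch-free phases `gammaArgPhase κ t = ∫₀ᵗ Re (Γ_ℝ'/Γ_ℝ)(½ + κ + iu) du` and
`dirichletArgS χ t = (1/π)(arg L(2, χ) + Im(i∫₀ᵗ L'/L(2 + iy, χ) dy) − Im ∫_{1/2}^2 L'/L(x + it, χ) dx)`
(`arg L` continued along `2 → 2 + it → ½ + it`, MV (14.5)). What is proved here is that Rumely's
objects ARE these:

* `TuringDirichlet.lfunctionTheta_eq` — **`θ(t, χ) = θ_κ(t) + (t/2) log q`** (`κ = a_χ`), from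
  `Γ_ℝ'/Γ_ℝ(s) = −½ log π + ½ ψ(s/2)` (`Literature.NumberTheory.LFunctions.logDeriv_Gammaℝ`);
* `TuringDirichlet.lfunctionArgS_eq_dirichletArgS` — **the ray form of `S(t, χ)` equals the path
  form** for `χ ≠ 1` and `t` the ordinate of no non-trivial zero: both are
  `(1/π)(arg L(2 + it, χ) − Im ∫_{1/2}^2 L'/L(x + it, χ) dx)`, because the principal `log L(x + it, χ)`
  is a primitive of `L'/L` along the ray `x ≥ 2` tending to `log 1 = 0`
  (`TuringDirichlet.integral_Ioi_logDeriv_LFunction`: `∫₂^∞ L'/L(x + it, χ) dx = −log L(2 + it, χ)`)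
  and along the segment `2 → 2 + it` (`TuringDirichlet.im_I_mul_integral_logDeriv_LFunction_two`);
  the supporting estimates on `Re s ≥ 2` (private helpers) — `‖L(s, χ) − 1‖ ≤ 2^{2−σ}(π²/6 − 1)`
  (hence `Re L > 0`) and `‖L'/L(s, χ)‖ ≤ 2^{2−σ} Σ Λ(n)/n²` — give the integrability of
  `σ ↦ L'/L(σ + it, χ)` on `(½, ∞)` (`TuringDirichlet.integrableOn_logDeriv_LFunction_Ioi_half`:
  Rumely's `S(t, χ)` is an honest Lebesgue integral off the ordinates). This is the Dirichlet-`L`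
  analogue of the tree's `ζ` ray section (`ZetaArgVariation.lean`, `integral_Ioi_logDeriv_riemannZeta`,
  `pi_mul_zetaArgS_eq_neg_integral_Ioi`);
* (private) the window `t₁ < γ ≤ t₂` of `lfunctionZeroCountIoc` is the window `t₁ < γ < t₂` of
  `DirichletTheta.pi_mul_finsum_zeroOrder_eq` when `t₂` is no ordinate;
* `rumely1993_eq3_holds` — **Rumely (3)**, assembled; `TuringDirichlet.lfunctionZeroCountIoc_eq` is
  the same identity under the weaker hypothesis that `t₁ < t₂` are ordinates of no NON-TRIVIAL zero.

## Conjugate pairs and Platt 2016, Theorem 3.2 (appended)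

Platt (Math. Comp. 85 (2016); arXiv:1305.3087 §3, Thm. 3.2, held text p. 5) specialises Booker's
theorem to Dirichlet `L`-functions, treats `χ, χ̄` "in pairs to avoid problems with the arbitrary
choice of `ε_χ`", and integrates from `t₀` to `t₀ + h`. PROVED here:

* `TuringDirichlet.lfunctionZeroCount_eq_theta_add_argS` — **the pair identity, pointwise**: for
  `T > 0` with `±T` ordinates of no non-trivial zero, `N_χ(T) = (2/π) θ(T, χ) + S_χ(T) + S_χ̄(T)`
  (`N_χ(T)` = `lfunctionZeroCount χ T`, zeros with `|γ| ≤ T`; `χ̄ = χ⁻¹`), from the tree's two-sided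
  MV Thm. 14.5 (`DirichletTheta.pi_mul_lfunctionZeroCount_eq`);
* `TuringDirichlet.lfunctionZeroCount_eq_add_Ioc` — **`N_χ(t) = N_χ(t₀) + Ñ_{t₀,χ}(t) + Ñ_{t₀,χ̄}(t)`**
  (`0 ≤ t₀ ≤ t`; `Ñ_{t₀,χ}(t) = lfunctionZeroCountIoc χ t₀ t`), an exact identity of counting functions
  (`TuringDirichlet.lfunctionZeroCountIoc_inv_eq`: the zeros of `χ̄` with `t₀ < γ ≤ t` are the
  conjugates of those of `χ` with `−t ≤ γ < −t₀`, multiplicities preserved);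
* `TuringDirichlet.continuous_lfunctionTheta`, `TuringDirichlet.intervalIntegrable_lfunctionArgS` —
  `θ(·, χ)` is continuous and **`S(·, χ)` is integrable on `[t₀, t₀ + h]`** (off the finitely many
  ordinates, (3) exhibits `S` as a monotone step function minus `θ/π` plus a constant) — the
  integrability that makes Turing's `∫ S(t, χ) dt` a Lebesgue integral;
* `TuringDirichlet.platt2016_theorem32_corrected` — **Platt's Theorem 3.2 in corrected form**:
  `h·N_χ(t₀) = (2/π)∫_{t₀}^{t₀+h} θ(t, χ) dt + ∫S_χ + ∫S_χ̄ − ∫Ñ_{t₀,χ} − ∫Ñ_{t₀,χ̄}` (`t₀ > 0`, `h ≥ 0`,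
  `±t₀` ordinates of no non-trivial zero). ERRATUM OF RECORD (parity-realchar cell, 2026-08-26, on
  TeX l.317 of arXiv:1305.3087v1 = journal p. 3014 = Platt's thesis Thm. 2.5.3): the printed display
  «`N_χ(t₀) = (1/(hπ))[2h + ((2ht₀+h²)/2) log(q/π) + 2∫ℑ log Γ((1/2+a_χ+it)/2) − ∫Ñ_χ − ∫Ñ_χ̄ + ∫S_χ + ∫S_χ̄]`»
  carries a spurious «`2h`» (the pole term «`+1`» of the `ζ`-count, twice; `Λ(s, χ)` is entire) and
  places `∫Ñ`, `∫S` under the factor `1/π`; the identity that Booker's theorem integrated over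
  `[t₀, t₀ + h]` yields — with `(1/π)[((2ht₀+h²)/2) log(q/π) + 2∫ℑ log Γ] = (2/π)∫θ(t, χ) dt` — is the
  one proved. (The tree's facts `platt2016_theorem71/72` are statements about zeros, unaffected.)

## Turing's method for `L(s, χ)`, assembled (appended; the Dirichlet twin of `TuringMethod.lean`)

* `TuringDirichlet.card_le_lfunctionZeroCountIoc`, `TuringDirichlet.card_le_lfunctionCriticalZeroCount`
  — found zeros on the critical line (distinct ordinates) bound `Ñ_{t₀,χ}` and `N_{χ,0}` from below;
* `TuringDirichlet.turing_lehman_lower_bound` — **the Turing–Lehman inequality for the pair**: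
  `h·N_χ(t₀) + Σ_Z(t₀+h−γ) + Σ_{Z'}(t₀+h−γ) − (2/π)∫θ ≤ ∫S_χ + ∫S_χ̄` for found zeros `Z`, `Z'` of
  `L_χ`, `L_χ̄` on the line in `(t₀, t₀ + h]` (Edwards §8.2 for `ζ`);
* `TuringDirichlet.lfunctionZeroCount_le_of_turing` — **Turing's method**: a bound
  `∫S_χ + ∫S_χ̄ ≤ B` and one real inequality give `N_χ(t₀) ≤ n`;
* `LFunctionRHUpTo.of_turing` — **the complete verification step**: `n` found zeros on the line with
  `|γ| ≤ t₀` + the above give `LFunctionRHUpTo χ t₀ ∧ N_χ(t₀) = N_{χ,0}(t₀) = n`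
  (via `LFunctionRHUpTo.of_count_sandwich`); `LFunctionRHUpTo.of_turing_rumely` plugs in Rumely's
  Theorem 2 (`t₀ > 50`), conditional only on the named fact `rumely1993_theorem2`.

## Littlewood's theorem for Dirichlet `L`-series (Rumely 1993, Lemma 3; appended)

* `TuringDirichlet.pi_mul_integral_lfunctionArgS_eq` — **Rumely 1993 Lemma 3 PROVED** («Littlewood's
  theorem for Dirichlet L-series», p. 429; Booker 2006 §4 «Littlewood's box principle», the starting
  point of his Theorem 4.6): for a primitive `χ`, `q > 1`, and real `t₁ ≤ t₂` ordinates of no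
  non-trivial zero,
  `π ∫_{t₁}^{t₂} S(t, χ) dt = ∫_{1/2}^∞ log ‖L(σ + it₂, χ)‖ dσ − ∫_{1/2}^∞ log ‖L(σ + it₁, χ)‖ dσ`
  — the Dirichlet twin of the tree's `pi_mul_integral_zetaArgS_eq` (`ZetaArgVariation.lean`): Fubini
  on `[t₁, t₂] × (½, ∞)` (joint integrability near the strip from the disc partial fraction
  `DirichletDisc.exists_norm_logDeriv_sub_sum_le` on windows of length `1/10` and the two-dimensional
  integrability of `1/|s − ρ|`, far out from `‖L'/L‖ ≤ 2^{2−σ}ΣΛ(n)/n²`), `∂_t log ‖L‖ = −Im L'/L`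
  along a.e. vertical ray, chained across intermediate non-ordinates;
  `TuringDirichlet.integrableOn_log_norm_LFunction` (the rays `∫ log ‖L‖` are Lebesgue integrals),
  `TuringDirichlet.intervalIntegrable_lfunctionArgS'` (integrability of `S` for every real base point).

With this the degree-one zero-counting step of Booker 2006 (4–6)–(4–8) / Platt 2016 Thm. 3.2 /
Rumely 1993 (3) is a theorem of the tree for every primitive Dirichlet character, and a Platt-type
GRH verification for `χ` up to height `t₀` is reduced to exactly its data (certified zeros on the line
below `t₀` and just above it, one explicit real inequality) plus ONE named fact, an explicit bound for
`∫ S(t, χ) dt` (`rumely1993_theorem2`, or `booker2006_theorem46_dirichlet` / Trudgian's constants of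
`CertifiedDirichletLTuringTrudgian.lean`); the computations themselves (`platt2016_theorem71/72`,
`rumely1993_theorem4`) stay vendored.

## References

* [Rumely1993ERH] R. Rumely, *Numerical computations concerning the ERH*, Math. Comp. 61 (1993)
  415–440, §4 p. 426, eq. (3); Lemma 3 («Littlewood's theorem for Dirichlet L-series») p. 429.
* [Booker2006] A. R. Booker, *Artin's conjecture, Turing's method, and the Riemann hypothesis*,
  Experiment. Math. 15 (2006) 385–407, §4 (4–1), (4–6)–(4–8) p. 394.
* [Platt2016GRH] D. J. Platt, *Numerical computations concerning the GRH*, Math. Comp. 85 (2016)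
  3009–3027, Thm. 3.2 (arXiv:1305.3087 §3).
* [MontgomeryVaughan2007] H. L. Montgomery, R. C. Vaughan, *Multiplicative Number Theory I*, CUP 2007,
  Theorem 14.5 and (14.5), p. 454.
-/

noncomputable section

open Complex Set MeasureTheory Filter Topology intervalIntegral
open scoped Real ComplexConjugate

namespace Literature.NumberTheory.LFunctions

open DirichletTheta DirichletCharacter ExplicitPsiChar Literature.Analysis.Complex

variable {q : ℕ} [NeZero q] {χ : DirichletCharacter ℂ q}

namespace TuringDirichlet

/-! ### The phase: `θ(t, χ) = θ_κ(t) + (t/2) log q` -/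

/-- `s/2` is no pole of `Γ` when `Re s > 0`. [folklore] -/
private theorem half_ne_neg_nat {s : ℂ} (hs : 0 < s.re) (m : ℕ) : s / 2 ≠ -m := by
  intro h
  have := congrArg Complex.re h
  simp at this
  linarith

/-- **`θ'(u, χ) = Re (Γ_ℝ'/Γ_ℝ)(½ + κ + iu) + ½ log q`**: Rumely's phase derivative
`Re ψ((½ + a_χ + iu)/2)/2 + log(q/π)/2` is the integrand of the tree's `gammaArgPhase` plus the
constant `½ log q` (`Γ_ℝ'/Γ_ℝ(s) = −½ log π + ½ ψ(s/2)`). [cite: Rumely1993ERH, §4 p. 426] -/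
theorem lfunctionThetaDeriv_eq (χ : DirichletCharacter ℂ q) (u : ℝ) :
    lfunctionThetaDeriv χ u =
      (logDeriv Gammaℝ (1 / 2 + (charParity χ : ℂ) + u * I)).re + Real.log q / 2 := by
  have hre : 0 < ((1 / 2 : ℂ) + (charParity χ : ℂ) + u * I).re := by
    simp
    positivity
  rw [lfunctionThetaDeriv, Literature.NumberTheory.LFunctions.logDeriv_Gammaℝ (half_ne_neg_nat hre),
    Real.log_div (by exact_mod_cast NeZero.ne q) Real.pi_ne_zero]
  have h1 : (Complex.log π).re = Real.log π := Complex.log_ofReal_re π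
  simp only [add_re, neg_re, div_ofNat_re, h1]
  ring

/-- **`θ(t, χ) = θ_κ(t) + (t/2) log q`**: Rumely's phase (`lfunctionTheta`, normalised `θ(0, χ) = 0`)
is Montgomery–Vaughan's `arg Γ(¼ + κ/2 + it/2) − (t/2) log π` (`gammaArgPhase κ t`) plus
`(t/2) log q`, `κ = a_χ`. [cite: Rumely1993ERH, §4 p. 426] -/
theorem lfunctionTheta_eq (χ : DirichletCharacter ℂ q) (t : ℝ) :
    lfunctionTheta χ t = gammaArgPhase (charParity χ) t + t / 2 * Real.log q := by
  have hcont : Continuous fun u : ℝ ↦ (logDeriv Gammaℝ (1 / 2 + (charParity χ : ℂ) + u * I)).re := by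
    refine Complex.continuous_re.comp (continuous_iff_continuousAt.2 fun u ↦ ?_)
    have hre : 0 < ((1 / 2 : ℂ) + (charParity χ : ℂ) + u * I).re := by
      simp
      positivity
    have hc : Continuous fun u : ℝ ↦ (1 / 2 : ℂ) + (charParity χ : ℂ) + u * I := by fun_prop
    exact (analyticAt_logDeriv_Gammaℝ hre).continuousAt.comp
      (f := fun u : ℝ ↦ (1 / 2 : ℂ) + (charParity χ : ℂ) + u * I) hc.continuousAt
  have hfun : lfunctionThetaDeriv χ =
      fun u : ℝ ↦ (logDeriv Gammaℝ (1 / 2 + (charParity χ : ℂ) + u * I)).re + Real.log q / 2 :=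
    funext (lfunctionThetaDeriv_eq χ)
  rw [lfunctionTheta, hfun, intervalIntegral.integral_add (hcont.intervalIntegrable _ _)
    intervalIntegrable_const, intervalIntegral.integral_const, gammaArgPhase, smul_eq_mul]
  ring

/-! ### `L(s, χ)` on the half-plane `σ ≥ 2`: `‖L − 1‖ ≤ 2^{2−σ}(π²/6 − 1)`, `‖L'/L‖ ≤ 2^{2−σ} Σ Λ(n)/n²` -/

/-- For `x ≥ 2` and `r ≥ 0`: `x^{-r} ≤ 2^{-r}`. [folklore] -/
private theorem rpow_neg_le_two_rpow_neg {x r : ℝ} (hx : 2 ≤ x) (hr : 0 ≤ r) :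
    x ^ (-r) ≤ (2 : ℝ) ^ (-r) := by
  rw [Real.rpow_neg (by linarith), Real.rpow_neg (by norm_num)]
  exact inv_anti₀ (by positivity) (Real.rpow_le_rpow (by norm_num) hx hr)

/-- **`‖L(s, χ) − 1‖ ≤ 2^{2−σ}(π²/6 − 1)` for `σ = Re s ≥ 2`** and every Dirichlet character `χ`
(compare `Σ_{n≥2} χ(n)n^{−s}` with `2^{2−σ}Σ_{n≥2} n^{−2}`); in particular `L(σ + it, χ) → 1`.
[folklore] -/
private theorem norm_LFunction_sub_one_le_of_two_le_re (χ : DirichletCharacter ℂ q) {s : ℂ} (hs : 2 ≤ s.re) :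
    ‖χ.LFunction s - 1‖ ≤ (2 : ℝ) ^ (2 - s.re) * (π ^ 2 / 6 - 1) := by
  have hs1 : 1 < s.re := by linarith
  rw [DirichletCharacter.LFunction_eq_LSeries χ hs1, LSeries]
  -- real comparison series `Σ_{n ≥ 2} n^{-2} = π²/6 − 1`
  have hreal : HasSum (fun n : ℕ ↦ (1 : ℝ) / ((n : ℝ) + 2) ^ 2) (π ^ 2 / 6 - 1) := by
    have h2 := (hasSum_nat_add_iff' 2).2 hasSum_zeta_two
    simp only [Finset.sum_range_succ, Finset.sum_range_zero, Nat.cast_zero, ne_eq,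
      OfNat.ofNat_ne_zero, not_false_eq_true, zero_pow, div_zero, zero_add, Nat.cast_one,
      one_pow, div_one] at h2
    have hfun : (fun n : ℕ ↦ (1 : ℝ) / ((n : ℝ) + 2) ^ 2) = fun n : ℕ ↦ 1 / ((n + 2 : ℕ) : ℝ) ^ 2 := by
      funext n; norm_cast
    rw [hfun]; exact h2
  -- termwise bound
  have hbound : ∀ n : ℕ, ‖LSeries.term (fun n : ℕ ↦ χ n) s (n + 2)‖ ≤
      (2 : ℝ) ^ (2 - s.re) * (1 / ((n : ℝ) + 2) ^ 2) := by
    intro n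
    rw [LSeries.norm_term_eq, if_neg (by omega)]
    have h1 : ‖χ ((n + 2 : ℕ) : ZMod q)‖ ≤ 1 := χ.norm_le_one _
    have hpos : (0 : ℝ) < ((n + 2 : ℕ) : ℝ) := by positivity
    have hn2 : (2 : ℝ) ≤ ((n + 2 : ℕ) : ℝ) := by
      push_cast; linarith [(Nat.cast_nonneg n : (0 : ℝ) ≤ n)]
    have hle : ‖χ ((n + 2 : ℕ) : ZMod q)‖ / ((n + 2 : ℕ) : ℝ) ^ s.re ≤ 1 / ((n + 2 : ℕ) : ℝ) ^ s.re :=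
      div_le_div_of_nonneg_right h1 (by positivity)
    refine hle.trans ?_
    have e1 : (1 : ℝ) / ((n + 2 : ℕ) : ℝ) ^ s.re =
        ((n + 2 : ℕ) : ℝ) ^ (-(s.re - 2)) * (1 / ((n + 2 : ℕ) : ℝ) ^ 2) := by
      rw [Real.rpow_neg hpos.le, ← Real.rpow_natCast _ 2, one_div, one_div, ← mul_inv,
        ← Real.rpow_add hpos]
      norm_num
    rw [e1]
    have e2 : ((n + 2 : ℕ) : ℝ) ^ (-(s.re - 2)) ≤ (2 : ℝ) ^ (2 - s.re) := by
      have := rpow_neg_le_two_rpow_neg hn2 (by linarith : 0 ≤ s.re - 2)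
      rwa [show -(s.re - 2) = 2 - s.re by ring] at this ⊢
    have e3 : (1 : ℝ) / ((n + 2 : ℕ) : ℝ) ^ 2 = 1 / ((n : ℝ) + 2) ^ 2 := by push_cast; ring
    rw [e3]
    exact mul_le_mul_of_nonneg_right e2 (by positivity)
  have hsum2 : Summable fun n : ℕ ↦ (2 : ℝ) ^ (2 - s.re) * (1 / ((n : ℝ) + 2) ^ 2) :=
    hreal.summable.mul_left _
  have hsumn : Summable fun n : ℕ ↦ ‖LSeries.term (fun n : ℕ ↦ χ n) s (n + 2)‖ :=
    hsum2.of_nonneg_of_le (fun n ↦ norm_nonneg _) hbound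
  have hsum : Summable fun n : ℕ ↦ LSeries.term (fun n : ℕ ↦ χ n) s (n + 2) := hsumn.of_norm
  have hsum' : Summable fun n : ℕ ↦ LSeries.term (fun n : ℕ ↦ χ n) s n :=
    (summable_nat_add_iff 2).1 hsum
  rw [← Summable.sum_add_tsum_nat_add 2 hsum', Finset.sum_range_succ, Finset.sum_range_succ,
    Finset.sum_range_zero, LSeries.term_zero, LSeries.term_of_ne_zero one_ne_zero]
  simp only [Nat.cast_one, map_one, one_cpow, div_one, zero_add, add_sub_cancel_left]
  refine (norm_tsum_le_tsum_norm hsumn).trans ?_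
  refine (Summable.tsum_le_tsum hbound hsumn hsum2).trans ?_
  rw [tsum_mul_left, hreal.tsum_eq]

/-- `π²/6 − 1 < 1`. [folklore] -/
private theorem pi_sq_div_six_sub_one_lt_one : π ^ 2 / 6 - 1 < 1 := by
  have h315 := Real.pi_lt_d2
  have h' : π ^ 2 < 3.15 ^ 2 := by gcongr
  norm_num at h'
  linarith

/-- **`Re L(s, χ) > 0` for `Re s ≥ 2`** (`‖L − 1‖ ≤ π²/6 − 1 < 1`): along the ray `σ ≥ 2` the
principal logarithm of `L(s, χ)` is continuous. [folklore] -/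
private theorem re_LFunction_pos_of_two_le_re (χ : DirichletCharacter ℂ q) {s : ℂ} (hs : 2 ≤ s.re) :
    0 < (χ.LFunction s).re := by
  have h := norm_LFunction_sub_one_le_of_two_le_re χ hs
  have hpow : (2 : ℝ) ^ (2 - s.re) ≤ 1 :=
    Real.rpow_le_one_of_one_le_of_nonpos (by norm_num) (by linarith)
  have hc : 0 ≤ π ^ 2 / 6 - 1 := by nlinarith [Real.pi_gt_three]
  have h' : ‖χ.LFunction s - 1‖ ≤ π ^ 2 / 6 - 1 :=
    h.trans ((mul_le_mul_of_nonneg_right hpow hc).trans_eq (one_mul _))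
  have h1 : |(χ.LFunction s - 1).re| ≤ ‖χ.LFunction s - 1‖ := Complex.abs_re_le_norm _
  rw [sub_re, one_re] at h1
  have := (abs_le.1 (h1.trans h')).1
  linarith [pi_sq_div_six_sub_one_lt_one]

open scoped LSeries.notation ArithmeticFunction.vonMangoldt in
/-- **`‖L'/L(s, χ)‖ ≤ 2^{2−σ} Σ Λ(n)/n²` for `σ = Re s ≥ 2`**
(`|L'/L(s, χ)| ≤ Σ Λ(n)n^{−σ}` and `n^{−σ} ≤ 2^{2−σ}n^{−2}` for `n ≥ 2`). [folklore] -/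
private theorem norm_logDeriv_LFunction_le_of_two_le_re (χ : DirichletCharacter ℂ q) {s : ℂ} (hs : 2 ≤ s.re) :
    ‖logDeriv χ.LFunction s‖ ≤ (2 : ℝ) ^ (2 - s.re) * ∑' n : ℕ, Λ n / (n : ℝ) ^ (2 : ℝ) := by
  have hs1 : 1 < s.re := by linarith
  obtain ⟨hsumσ, hle⟩ := DirichletZFR.norm_LSeries_twist_le χ hs1
  have hsum2 : Summable fun n : ℕ ↦ Λ n / (n : ℝ) ^ (2 : ℝ) := by
    have := (DirichletZFR.norm_LSeries_twist_le χ (s := (2 : ℂ)) (by norm_num)).1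
    simpa using this
  have hterm : ∀ n : ℕ, Λ n / (n : ℝ) ^ s.re ≤ (2 : ℝ) ^ (2 - s.re) * (Λ n / (n : ℝ) ^ (2 : ℝ)) := by
    intro n
    rcases Nat.lt_or_ge n 2 with hn | hn
    · interval_cases n
      · simp [Real.zero_rpow (by linarith : s.re ≠ 0)]
      · simp [ArithmeticFunction.vonMangoldt_apply_one]
    · have hpos : (0 : ℝ) < n := by exact_mod_cast (by omega : 0 < n)
      have hΛ : 0 ≤ Λ n := ArithmeticFunction.vonMangoldt_nonneg
      rw [div_eq_mul_inv, div_eq_mul_inv, ← Real.rpow_neg hpos.le, ← Real.rpow_neg hpos.le]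
      have e : (n : ℝ) ^ (-s.re) = (n : ℝ) ^ (-(s.re - 2)) * (n : ℝ) ^ (-(2 : ℝ)) := by
        rw [← Real.rpow_add hpos]; ring_nf
      rw [e]
      have e2 : (n : ℝ) ^ (-(s.re - 2)) ≤ (2 : ℝ) ^ (2 - s.re) := by
        have := rpow_neg_le_two_rpow_neg (by exact_mod_cast hn : (2 : ℝ) ≤ n)
          (by linarith : 0 ≤ s.re - 2)
        rwa [show -(s.re - 2) = 2 - s.re by ring] at this ⊢
      calc Λ n * ((n : ℝ) ^ (-(s.re - 2)) * (n : ℝ) ^ (-(2 : ℝ)))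
          = (n : ℝ) ^ (-(s.re - 2)) * (Λ n * (n : ℝ) ^ (-(2 : ℝ))) := by ring
        _ ≤ (2 : ℝ) ^ (2 - s.re) * (Λ n * (n : ℝ) ^ (-(2 : ℝ))) :=
          mul_le_mul_of_nonneg_right e2 (by positivity)
  rw [logDeriv_apply, ← norm_neg, DirichletZFR.neg_logDeriv_LFunction_eq χ hs1]
  refine hle.trans ?_
  calc ∑' n : ℕ, Λ n / (n : ℝ) ^ s.re
      ≤ ∑' n : ℕ, (2 : ℝ) ^ (2 - s.re) * (Λ n / (n : ℝ) ^ (2 : ℝ)) :=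
        Summable.tsum_le_tsum hterm hsumσ (hsum2.mul_left _)
    _ = _ := tsum_mul_left

/-! ### `L'/L` along a horizontal ray: continuity, integrability, `arg L(2 + it) = −Im ∫₂^∞ L'/L` -/

/-- `L'/L(·, χ)` is continuous where `L ≠ 0` (`χ ≠ 1`, so that `L` is entire). [folklore] -/
private theorem continuousAt_logDeriv_LFunction (h1 : χ ≠ 1) {s : ℂ} (hs : χ.LFunction s ≠ 0) :
    ContinuousAt (logDeriv χ.LFunction) s := by
  have hd := differentiable_LFunction h1
  have hc : Continuous (deriv χ.LFunction) := (hd.contDiff (n := 1)).continuous_deriv le_rfl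
  have e : logDeriv χ.LFunction = fun z ↦ deriv χ.LFunction z / χ.LFunction z :=
    funext fun z ↦ logDeriv_apply _ _
  rw [e]
  exact hc.continuousAt.div hd.continuous.continuousAt hs

open scoped LSeries.notation ArithmeticFunction.vonMangoldt in
/-- `x ↦ L'/L(x + it, χ)` is integrable on `(2, ∞)` (dominated by `C·2^{2−x}`). [folklore] -/
private theorem integrableOn_logDeriv_LFunction_Ioi_two (h1 : χ ≠ 1) (t : ℝ) :
    IntegrableOn (fun x : ℝ ↦ logDeriv χ.LFunction (x + t * I)) (Ioi 2) := by
  set C : ℝ := ∑' n : ℕ, Λ n / (n : ℝ) ^ (2 : ℝ) with hC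
  have hdom : IntegrableOn (fun x : ℝ ↦ C * (4 * Real.exp (-Real.log 2 * x))) (Ioi 2) :=
    ((exp_neg_integrableOn_Ioi 2 (Real.log_pos (by norm_num))).const_mul 4).const_mul C
  have hcont : ContinuousOn (fun x : ℝ ↦ logDeriv χ.LFunction (x + t * I)) (Ioi 2) := by
    intro x hx
    have hL : χ.LFunction (x + t * I) ≠ 0 :=
      LFunction_ne_zero_of_one_le_re χ (Or.inl h1) (by simp; exact le_trans (by norm_num) (le_of_lt hx))
    have hc : Continuous fun x : ℝ ↦ (x : ℂ) + t * I := by fun_prop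
    exact ((continuousAt_logDeriv_LFunction h1 hL).comp (f := fun x : ℝ ↦ (x : ℂ) + t * I)
      hc.continuousAt).continuousWithinAt
  refine hdom.mono' (hcont.aestronglyMeasurable measurableSet_Ioi) ?_
  refine (ae_restrict_iff' measurableSet_Ioi).2 (Eventually.of_forall fun x hx ↦ ?_)
  have h := norm_logDeriv_LFunction_le_of_two_le_re χ (s := x + t * I) (by simp; exact le_of_lt hx)
  simp only [add_re, ofReal_re, mul_re, ofReal_im, I_re, mul_zero, I_im, mul_one, sub_self,
    add_zero] at h
  refine h.trans (le_of_eq ?_)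
  rw [Real.rpow_def_of_pos (by norm_num), hC]
  have : Real.log 2 * (2 - x) = 2 * Real.log 2 + -Real.log 2 * x := by ring
  rw [this, Real.exp_add, show (2 : ℝ) * Real.log 2 = Real.log 4 by
    rw [show (4 : ℝ) = 2 ^ 2 by norm_num, Real.log_pow]; norm_num, Real.exp_log (by norm_num)]
  ring

/-- `L(x + it, χ)` lies in the slit plane for `x ≥ 2`, and `L` is analytic there. [folklore] -/
private theorem slit_and_analytic (h1 : χ ≠ 1) (t : ℝ) {x : ℝ} (hx : 2 ≤ x) :
    χ.LFunction (x + t * I) ∈ slitPlane ∧ AnalyticAt ℂ χ.LFunction (x + t * I) :=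
  ⟨Or.inl (re_LFunction_pos_of_two_le_re χ (by simpa using hx)),
    (differentiable_LFunction h1).analyticAt _⟩

/-- **`arg L(2 + it, χ) = −Im ∫₂^∞ L'/L(x + it, χ) dx`**, indeed
`∫₂^∞ L'/L(x + it, χ) dx = −log L(2 + it, χ)`: the principal `log L(x + it, χ)` is a primitive of
`L'/L` along the ray `x ≥ 2` (where `Re L > 0`) and tends to `log 1 = 0`. This is the meaning of
Rumely's / Booker's / Platt's "`∫_∞^{…}`" (continuation along the horizontal line from `+∞`).
[cite: Booker2006, §4 (4–1) p. 394] -/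
theorem integral_Ioi_logDeriv_LFunction (h1 : χ ≠ 1) (t : ℝ) :
    ∫ x in Ioi (2 : ℝ), logDeriv χ.LFunction (x + t * I) = -Complex.log (χ.LFunction (2 + t * I)) := by
  have hderiv : ∀ x ∈ Ioi (2 : ℝ), HasDerivAt (fun x : ℝ ↦ Complex.log (χ.LFunction (x + t * I)))
      (logDeriv χ.LFunction (x + t * I)) x := fun x hx ↦ by
    rw [logDeriv_apply]
    exact hasDerivAt_log_comp_horizontal (slit_and_analytic h1 t (le_of_lt hx)).2
      (slit_and_analytic h1 t (le_of_lt hx)).1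
  have hcont : ContinuousWithinAt (fun x : ℝ ↦ Complex.log (χ.LFunction (x + t * I))) (Ici 2) 2 :=
    (hasDerivAt_log_comp_horizontal (slit_and_analytic h1 t le_rfl).2
      (slit_and_analytic h1 t le_rfl).1).continuousAt.continuousWithinAt
  -- `log L(x + it, χ) → 0`
  have hlim : Tendsto (fun x : ℝ ↦ Complex.log (χ.LFunction (x + t * I))) atTop (𝓝 0) := by
    have hpow : Tendsto (fun x : ℝ ↦ (2 : ℝ) ^ (2 - x)) atTop (𝓝 0) := by
      have h1' : Tendsto (fun x : ℝ ↦ Real.log 2 * (2 + -x)) atTop atBot :=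
        (tendsto_atBot_add_const_left _ 2 tendsto_neg_atTop_atBot).const_mul_atBot
          (Real.log_pos (by norm_num))
      refine (Real.tendsto_exp_atBot.comp h1').congr fun x ↦ ?_
      rw [Function.comp_apply, Real.rpow_def_of_pos (by norm_num)]
      ring_nf
    have hL : Tendsto (fun x : ℝ ↦ χ.LFunction (x + t * I)) atTop (𝓝 1) := by
      refine tendsto_iff_norm_sub_tendsto_zero.2 ?_
      have hb : Tendsto (fun x : ℝ ↦ (2 : ℝ) ^ (2 - x) * (π ^ 2 / 6 - 1)) atTop (𝓝 0) := by
        simpa using hpow.mul_const (π ^ 2 / 6 - 1)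
      refine squeeze_zero_norm' ?_ hb
      filter_upwards [eventually_ge_atTop (2 : ℝ)] with x hx
      rw [norm_norm]
      have := norm_LFunction_sub_one_le_of_two_le_re χ (s := x + t * I) (by simpa using hx)
      simpa using this
    have := ((continuousAt_clog (by simp : (1 : ℂ) ∈ slitPlane)).tendsto.comp hL)
    rw [Complex.log_one] at this
    exact this
  have h := MeasureTheory.integral_Ioi_of_hasDerivAt_of_tendsto hcont hderiv
    (integrableOn_logDeriv_LFunction_Ioi_two h1 t) hlim
  simpa using h

/-- `L(x + it, χ) ≠ 0` for `x ≥ 1/2` when `t` is the ordinate of no non-trivial zero (`χ ≠ 1`). [folklore] -/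
private theorem LFunction_ne_zero_of_half_le (h1 : χ ≠ 1) {t : ℝ}
    (ht : ∀ ρ ∈ charNontrivialZeros χ, ρ.im ≠ t) {x : ℝ} (hx : 1 / 2 ≤ x) :
    χ.LFunction (x + t * I) ≠ 0 := by
  intro hL
  rcases lt_or_ge x 1 with hx1 | hx1
  · exact ht _ (mem_charNontrivialZeros.2 ⟨hL, by simp; linarith, by simpa using hx1⟩) (by simp)
  · exact LFunction_ne_zero_of_one_le_re χ (Or.inl h1) (by simpa using hx1) hL

/-- **`σ ↦ L'/L(σ + it, χ)` is integrable on `(½, ∞)`** when `t` is the ordinate of no non-trivial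
zero (continuous on `[½, 2]`, exponentially small beyond): Rumely's `S(t, χ)` is an honest integral.
[cite: Rumely1993ERH, §4 p. 426] -/
theorem integrableOn_logDeriv_LFunction_Ioi_half (h1 : χ ≠ 1) {t : ℝ}
    (ht : ∀ ρ ∈ charNontrivialZeros χ, ρ.im ≠ t) :
    IntegrableOn (fun x : ℝ ↦ logDeriv χ.LFunction (x + t * I)) (Ioi (1 / 2 : ℝ)) := by
  have hcontF : ContinuousOn (fun x : ℝ ↦ logDeriv χ.LFunction (x + t * I)) (Icc (1 / 2) 2) := by
    intro x hx
    have hc : Continuous fun x : ℝ ↦ (x : ℂ) + t * I := by fun_prop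
    exact ((continuousAt_logDeriv_LFunction h1 (LFunction_ne_zero_of_half_le h1 ht hx.1)).comp
      (f := fun x : ℝ ↦ (x : ℂ) + t * I) hc.continuousAt).continuousWithinAt
  have hF1 : IntegrableOn (fun x : ℝ ↦ logDeriv χ.LFunction (x + t * I)) (Ioc (1 / 2) 2) :=
    (hcontF.integrableOn_compact isCompact_Icc).mono_set Ioc_subset_Icc_self
  rw [← Ioc_union_Ioi_eq_Ioi (show (1 / 2 : ℝ) ≤ 2 by norm_num)]
  exact hF1.union (integrableOn_logDeriv_LFunction_Ioi_two h1 t)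

/-- **The vertical variation: `Im(i∫₀ᵗ L'/L(2 + iy, χ) dy) = arg L(2 + it, χ) − arg L(2, χ)`**
(principal values; `Re L > 0` on `Re s = 2`), for `t` of either sign. [cite: MontgomeryVaughan2007, Theorem 14.5 (14.5)] -/
theorem im_I_mul_integral_logDeriv_LFunction_two (h1 : χ ≠ 1) (t : ℝ) :
    (I * ∫ y in (0 : ℝ)..t, logDeriv χ.LFunction (2 + y * I)).im =
      arg (χ.LFunction (2 + t * I)) - arg (χ.LFunction 2) := by
  have han : ∀ y : ℝ, AnalyticAt ℂ χ.LFunction ((2 : ℝ) + y * I) := fun y ↦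
    (differentiable_LFunction h1).analyticAt _
  have hslit : ∀ y : ℝ, χ.LFunction ((2 : ℝ) + y * I) ∈ slitPlane := fun y ↦
    Or.inl (re_LFunction_pos_of_two_le_re χ (by simp))
  have key : ∀ {c d : ℝ}, c ≤ d →
      I * ∫ y in c..d, logDeriv χ.LFunction (2 + y * I) =
        Complex.log (χ.LFunction (2 + d * I)) - Complex.log (χ.LFunction (2 + c * I)) := by
    intro c d hcd
    have h2 := integral_logDeriv_vertical (g := χ.LFunction) 2 hcd (fun y _ ↦ han y) (fun y _ ↦ hslit y)
    simp only [ofReal_ofNat] at h2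
    rw [← h2]
    congr 1
  rcases le_or_gt 0 t with ht | ht
  · rw [key ht, sub_im, log_im, log_im]
    simp
  · rw [intervalIntegral.integral_symm, mul_neg, key ht.le, neg_im, sub_im, log_im, log_im]
    simp

/-- **Rumely's / Booker's / Platt's `S(t, χ)` IS Montgomery–Vaughan's `S(t, χ)`** off the ordinates:
for `χ ≠ 1` and `t` the ordinate of no non-trivial zero,
`−(1/π)∫_{1/2}^∞ Im (L'/L)(σ + it, χ) dσ = (1/π)(arg L(2, χ) + Im(i∫₀ᵗ L'/L(2 + iy)) − Im ∫_{1/2}^2 L'/L(x + it))`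
(`lfunctionArgS χ t = dirichletArgS χ t`): the continuation of `arg L` along the ray from `+∞ + it`
(Rumely §4; Booker (4–1); Platt Thm. 3.2) and along `2 → 2 + it → ½ + it` (MV (14.5)) agree, both
being `arg L(2 + it, χ) − Im ∫_{1/2}^2 L'/L(x + it, χ) dx`. [cite: Rumely1993ERH, §4 p. 426] -/
theorem lfunctionArgS_eq_dirichletArgS (h1 : χ ≠ 1) {t : ℝ}
    (ht : ∀ ρ ∈ charNontrivialZeros χ, ρ.im ≠ t) :
    lfunctionArgS χ t = dirichletArgS χ t := by
  set F : ℝ → ℂ := fun x ↦ logDeriv χ.LFunction (x + t * I) with hF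
  have hunion : IntegrableOn F (Ioi (1 / 2)) := integrableOn_logDeriv_LFunction_Ioi_half h1 ht
  have hF1 : IntegrableOn F (Ioc (1 / 2) 2) := hunion.mono_set Ioc_subset_Ioi_self
  have hF2 : IntegrableOn F (Ioi 2) := integrableOn_logDeriv_LFunction_Ioi_two h1 t
  have hsplit : ∫ x in Ioi (1 / 2 : ℝ), F x = (∫ x in (1 / 2 : ℝ)..2, F x) + ∫ x in Ioi (2 : ℝ), F x := by
    rw [intervalIntegral.integral_of_le (by norm_num),
      ← setIntegral_union (Ioc_disjoint_Ioi le_rfl) measurableSet_Ioi hF1 hF2,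
      Ioc_union_Ioi_eq_Ioi (by norm_num)]
  have him : ∫ x in Ioi (1 / 2 : ℝ), (F x).im = (∫ x in Ioi (1 / 2 : ℝ), F x).im := integral_im hunion
  -- the integrand of `lfunctionArgS` is `Im F`
  have hint : (∫ σ in Ioi (1 / 2 : ℝ),
      (deriv χ.LFunction ((σ : ℂ) + (t : ℂ) * I) / χ.LFunction ((σ : ℂ) + (t : ℂ) * I)).im) =
      ∫ x in Ioi (1 / 2 : ℝ), (F x).im := by
    refine setIntegral_congr_fun measurableSet_Ioi fun x _ ↦ ?_
    simp only [hF, logDeriv_apply]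
  have htail : (∫ x in Ioi (2 : ℝ), F x).im = -arg (χ.LFunction (2 + t * I)) := by
    simp only [hF]
    rw [integral_Ioi_logDeriv_LFunction h1 t, neg_im, log_im]
  have hvert := im_I_mul_integral_logDeriv_LFunction_two h1 t
  have hπ : π ≠ 0 := Real.pi_ne_zero
  rw [lfunctionArgS, dirichletArgS, hint, him, hsplit, add_im, htail, hvert]
  field_simp
  ring

/-- The window count of `CertifiedDirichletLTuringMethod.lean` (`t₁ < γ ≤ t₂`) is the open-window
count of `DirichletLZeroCounting.lean` (`t₁ < γ < t₂`) when `t₂` is the ordinate of no zero. [folklore] -/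
private theorem lfunctionZeroCountIoc_eq_finsum {t₁ t₂ : ℝ} (ht₂ : ∀ ρ ∈ charNontrivialZeros χ, ρ.im ≠ t₂) :
    lfunctionZeroCountIoc χ t₁ t₂ =
      ∑ᶠ ρ ∈ {ρ : ℂ | ρ ∈ charNontrivialZeros χ ∧ t₁ < ρ.im ∧ ρ.im < t₂}, DirichletDisc.zeroOrder χ ρ := by
  have hset : {ρ : ℂ | χ.LFunction ρ = 0 ∧ 0 < ρ.re ∧ ρ.re < 1 ∧ t₁ < ρ.im ∧ ρ.im ≤ t₂} =
      {ρ : ℂ | ρ ∈ charNontrivialZeros χ ∧ t₁ < ρ.im ∧ ρ.im < t₂} := by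
    ext ρ
    simp only [mem_setOf_eq, mem_charNontrivialZeros]
    constructor
    · rintro ⟨hL, h0, h1, ha, hb⟩
      exact ⟨⟨hL, h0, h1⟩, ha, lt_of_le_of_ne hb (ht₂ ρ ⟨hL, h0, h1⟩)⟩
    · rintro ⟨⟨hL, h0, h1⟩, ha, hb⟩
      exact ⟨hL, h0, h1, ha, hb.le⟩
  rw [lfunctionZeroCountIoc, hset]

end TuringDirichlet

/-! ### The discharge -/

open TuringDirichlet in
/-- **Rumely 1993, §4 eq. (3) — PROVED** (discharge of the named fact `rumely1993_eq3` of
`CertifiedDirichletLTuringMethod.lean`): for a primitive `χ` of conductor `q > 1` and `t₁ < t₂`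
ordinates of no zero of `L(s, χ)`,
`N(t, χ)|_{t₁}^{t₂} = (1/π) θ(t, χ)|_{t₁}^{t₂} + S(t, χ)|_{t₁}^{t₂}`.
Proof: the tree's Montgomery–Vaughan Theorem 14.5 in Backlund's two-height form
(`DirichletTheta.pi_mul_finsum_zeroOrder_eq`: argument principle for `ξ(s, χ)` on `[−1, 2] × [t₁, t₂]`
folded by `ξ(1 − s̄, χ) = ε(χ)·conj ξ(s, χ)`), with `θ(t, χ) = θ_κ(t) + (t/2) log q`
(`lfunctionTheta_eq`) and `S(t, χ)` (ray form) `= S(t, χ)` (MV's path form) (`lfunctionArgS_eq_dirichletArgS`).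
[cite: Rumely1993ERH, §4 eq. (3) p. 426] -/
theorem rumely1993_eq3_holds : rumely1993_eq3 := by
  intro q _ hq χ hχ t₁ t₂ ht hz
  have hq1 : q ≠ 1 := by omega
  have h1 : χ ≠ 1 := SelbergDirichlet.ne_one_of_isPrimitive hq1 hχ
  have ht₁ : ∀ ρ ∈ charNontrivialZeros χ, ρ.im ≠ t₁ := fun ρ hρ ↦ (hz ρ hρ.1).1
  have ht₂ : ∀ ρ ∈ charNontrivialZeros χ, ρ.im ≠ t₂ := fun ρ hρ ↦ (hz ρ hρ.1).2
  have hmain := DirichletTheta.pi_mul_finsum_zeroOrder_eq hχ hq1 ht ht₁ ht₂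
  rw [← lfunctionZeroCountIoc_eq_finsum ht₂, ← lfunctionArgS_eq_dirichletArgS h1 ht₁,
    ← lfunctionArgS_eq_dirichletArgS h1 ht₂] at hmain
  rw [lfunctionTheta_eq, lfunctionTheta_eq]
  have hπ : π ≠ 0 := Real.pi_ne_zero
  field_simp
  linarith [hmain]

/-! ### Rumely (3) with the hypothesis on non-trivial zeros only; conjugate pairs (Platt 2016, Thm. 3.2) -/

namespace TuringDirichlet

/-- **Rumely (3)** with the (weaker, and natural) hypothesis that `t₁ < t₂` are ordinates of no
NON-TRIVIAL zero of `L(s, χ)` (primitive `χ`, conductor `q > 1`):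
`N(t, χ)|_{t₁}^{t₂} = (1/π) θ(t, χ)|_{t₁}^{t₂} + S(t, χ)|_{t₁}^{t₂}`. [cite: Rumely1993ERH, §4 eq. (3) p. 426] -/
theorem lfunctionZeroCountIoc_eq (hχ : χ.IsPrimitive) (hq : 1 < q) {t₁ t₂ : ℝ} (ht : t₁ < t₂)
    (ht₁ : ∀ ρ ∈ charNontrivialZeros χ, ρ.im ≠ t₁) (ht₂ : ∀ ρ ∈ charNontrivialZeros χ, ρ.im ≠ t₂) :
    (lfunctionZeroCountIoc χ t₁ t₂ : ℝ) =
      (lfunctionTheta χ t₂ - lfunctionTheta χ t₁) / π + (lfunctionArgS χ t₂ - lfunctionArgS χ t₁) := by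
  have hq1 : q ≠ 1 := by omega
  have h1 : χ ≠ 1 := SelbergDirichlet.ne_one_of_isPrimitive hq1 hχ
  have hmain := DirichletTheta.pi_mul_finsum_zeroOrder_eq hχ hq1 ht ht₁ ht₂
  rw [← lfunctionZeroCountIoc_eq_finsum ht₂, ← lfunctionArgS_eq_dirichletArgS h1 ht₁,
    ← lfunctionArgS_eq_dirichletArgS h1 ht₂] at hmain
  rw [lfunctionTheta_eq, lfunctionTheta_eq]
  have hπ : π ≠ 0 := Real.pi_ne_zero
  field_simp
  linarith [hmain]

omit [NeZero q] in
/-- The inverse (conjugate) of a primitive character is primitive (same conductor). [folklore] -/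
private theorem isPrimitive_inv (hχ : χ.IsPrimitive) : χ⁻¹.IsPrimitive := by
  rw [DirichletCharacter.isPrimitive_def, DirichletCharacter.conductor_inv]
  exact hχ

/-- `t` is the ordinate of no non-trivial zero of `L(s, χ̄)` iff `−t` is the ordinate of none of
`L(s, χ)` (the zeros of `χ̄` are the conjugates of those of `χ`). [folklore] -/
private theorem forall_im_ne_inv (h1 : χ ≠ 1) {t : ℝ} (ht : ∀ ρ ∈ charNontrivialZeros χ, ρ.im ≠ -t) :
    ∀ ρ ∈ charNontrivialZeros χ⁻¹, ρ.im ≠ t := by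
  intro ρ hρ h
  have hρ' : conj ρ ∈ charNontrivialZeros χ := by
    have := (conj_mem_charNontrivialZeros_inv (χ := χ⁻¹) (inv_ne_one.mpr h1) (ρ := ρ)).2 hρ
    rwa [inv_inv] at this
  exact ht _ hρ' (by rw [Complex.conj_im, h])

/-- **Booker's theorem for the conjugate pair `χ, χ̄`** (Booker 2006 §4 for `r = 1`, `N = q`,
`μ₁ = a_χ`; Platt 2016 Thm. 3.1 → Thm. 3.2, pointwise form before integration): for a primitive `χ` of
conductor `q > 1` and `T > 0` with `±T` ordinates of no non-trivial zero,
`N_χ(T) = (2/π) θ(T, χ) + S_χ(T) + S_χ̄(T)`,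
where `N_χ(T)` counts the zeros with `0 < β < 1`, `|γ| ≤ T` (`lfunctionZeroCount`). The `arg ε`
of Booker's `Φ` cancels between `T` and `−T` and `S_χ(−T) = −S_χ̄(T)` — Platt: "we treat conjugate
characters in pairs to avoid problems with the arbitrary choice of `ε_χ`". From the tree's two-sided
MV Thm. 14.5 (`DirichletTheta.pi_mul_lfunctionZeroCount_eq`) and the two bridges above.
[cite: Platt2016GRH, Theorem 3.2] -/
theorem lfunctionZeroCount_eq_theta_add_argS (hχ : χ.IsPrimitive) (hq : 1 < q) {T : ℝ} (hT : 0 < T)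
    (hTp : ∀ ρ ∈ charNontrivialZeros χ, ρ.im ≠ T) (hTm : ∀ ρ ∈ charNontrivialZeros χ, ρ.im ≠ -T) :
    (lfunctionZeroCount χ T : ℝ) =
      2 / π * lfunctionTheta χ T + (lfunctionArgS χ T + lfunctionArgS χ⁻¹ T) := by
  have hq1 : q ≠ 1 := by omega
  have h1 : χ ≠ 1 := SelbergDirichlet.ne_one_of_isPrimitive hq1 hχ
  have h1' : χ⁻¹ ≠ 1 := inv_ne_one.mpr h1
  have h := pi_mul_lfunctionZeroCount_eq hχ hq1 hT hTp hTm
  rw [← lfunctionArgS_eq_dirichletArgS h1 hTp,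
    ← lfunctionArgS_eq_dirichletArgS h1' (forall_im_ne_inv h1 hTm)] at h
  rw [lfunctionTheta_eq]
  have hπ : π ≠ 0 := Real.pi_ne_zero
  field_simp
  linarith [h]

/-- **Zeros of `χ̄` above `t₀` are zeros of `χ` below `−t₀`**: for `χ ≠ 1` and real `t₀ ≤ t`, the
window count `#{ρ : L(ρ, χ̄) = 0, 0 < β < 1, t₀ < γ ≤ t}` equals `#{ρ : L(ρ, χ) = 0, 0 < β < 1, −t ≤ γ < −t₀}`
(with multiplicities, `m_{χ̄}(ρ̄) = m_χ(ρ)`). [cite: MontgomeryVaughan2007, Theorem 14.5 (remark p. 454)] -/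
theorem lfunctionZeroCountIoc_inv_eq (h1 : χ ≠ 1) (t₀ t : ℝ) :
    lfunctionZeroCountIoc χ⁻¹ t₀ t =
      ∑ᶠ ρ ∈ {ρ : ℂ | ρ ∈ charNontrivialZeros χ ∧ -t ≤ ρ.im ∧ ρ.im < -t₀}, DirichletDisc.zeroOrder χ ρ := by
  have hset : {ρ : ℂ | χ⁻¹.LFunction ρ = 0 ∧ 0 < ρ.re ∧ ρ.re < 1 ∧ t₀ < ρ.im ∧ ρ.im ≤ t} =
      (starRingEnd ℂ) '' {ρ : ℂ | ρ ∈ charNontrivialZeros χ ∧ -t ≤ ρ.im ∧ ρ.im < -t₀} := by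
    ext ρ
    simp only [mem_setOf_eq, mem_image]
    constructor
    · rintro ⟨hL, h0, h1r, ha, hb⟩
      have hmem : ρ ∈ charNontrivialZeros χ⁻¹ := mem_charNontrivialZeros.2 ⟨hL, h0, h1r⟩
      refine ⟨conj ρ, ⟨?_, ?_, ?_⟩, Complex.conj_conj ρ⟩
      · have := (conj_mem_charNontrivialZeros_inv (χ := χ⁻¹) (inv_ne_one.mpr h1) (ρ := ρ)).2 hmem
        rwa [inv_inv] at this
      · rw [Complex.conj_im]; linarith
      · rw [Complex.conj_im]; linarith
    · rintro ⟨w, ⟨hw, h3, h4⟩, rfl⟩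
      have hw' := mem_charNontrivialZeros.1 ((conj_mem_charNontrivialZeros_inv h1).2 hw)
      exact ⟨hw'.1, hw'.2.1, hw'.2.2, by rw [Complex.conj_im]; linarith,
        by rw [Complex.conj_im]; linarith⟩
  rw [lfunctionZeroCountIoc, hset, finsum_mem_image (starRingEnd ℂ).injective.injOn]
  exact finsum_mem_congr rfl fun ρ _ ↦ WeilConverseChar.zeroOrder_inv_conj h1 ρ

/-- **`N_χ(t) = N_χ(t₀) + Ñ_{t₀,χ}(t) + Ñ_{t₀,χ̄}(t)`** for `0 ≤ t₀ ≤ t` (`χ ≠ 1`): the zeros with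
`t₀ < |γ| ≤ t` are those of `χ` with `t₀ < γ ≤ t` and the conjugates of those of `χ̄` with `t₀ < γ ≤ t`
(Platt: "`Ñ_{t₀,χ}(t)` count[s] the zeros of `L_χ(s)` with `ℑ(s) ∈ [t₀, t)` …", the pair `χ, χ̄`
accounting for both signs of the ordinate). An exact identity of counting functions, no hypothesis on
ordinates. [cite: Platt2016GRH, Theorem 3.2] -/
theorem lfunctionZeroCount_eq_add_Ioc (h1 : χ ≠ 1) {t₀ t : ℝ} (ht₀ : 0 ≤ t₀) (ht : t₀ ≤ t) :
    lfunctionZeroCount χ t =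
      lfunctionZeroCount χ t₀ + lfunctionZeroCountIoc χ t₀ t + lfunctionZeroCountIoc χ⁻¹ t₀ t := by
  set A : Set ℂ := {ρ : ℂ | χ.LFunction ρ = 0 ∧ 0 < ρ.re ∧ ρ.re < 1 ∧ t₀ < ρ.im ∧ ρ.im ≤ t} with hA
  set B : Set ℂ := {ρ : ℂ | ρ ∈ charNontrivialZeros χ ∧ -t ≤ ρ.im ∧ ρ.im < -t₀} with hB
  have hfin : (lfunctionZeroBox χ t).Finite := lfunctionZeroBox_finite h1 t
  have hsub0 : lfunctionZeroBox χ t₀ ⊆ lfunctionZeroBox χ t := fun ρ hρ ↦ by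
    obtain ⟨hL, h0, h1r, habs⟩ := mem_lfunctionZeroBox.1 hρ
    exact mem_lfunctionZeroBox.2 ⟨hL, h0, h1r, habs.trans ht⟩
  have hsubA : A ⊆ lfunctionZeroBox χ t := fun ρ hρ ↦ by
    obtain ⟨hL, h0, h1r, ha, hb⟩ := hρ
    exact mem_lfunctionZeroBox.2 ⟨hL, h0, h1r, abs_le.2 ⟨by linarith, hb⟩⟩
  have hsubB : B ⊆ lfunctionZeroBox χ t := fun ρ hρ ↦ by
    obtain ⟨hmem, ha, hb⟩ := hρ
    obtain ⟨hL, h0, h1r⟩ := mem_charNontrivialZeros.1 hmem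
    exact mem_lfunctionZeroBox.2 ⟨hL, h0, h1r, abs_le.2 ⟨ha, by linarith⟩⟩
  have hunion : lfunctionZeroBox χ t = (lfunctionZeroBox χ t₀ ∪ A) ∪ B := by
    ext ρ
    simp only [mem_union, mem_lfunctionZeroBox, hA, hB, mem_setOf_eq, mem_charNontrivialZeros, abs_le]
    constructor
    · rintro ⟨hL, h0, h1r, hm, hp⟩
      rcases le_or_gt ρ.im t₀ with hle | hlt
      · rcases lt_or_ge ρ.im (-t₀) with hlt' | hge
        · exact Or.inr ⟨⟨hL, h0, h1r⟩, hm, hlt'⟩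
        · exact Or.inl (Or.inl ⟨hL, h0, h1r, hge, hle⟩)
      · exact Or.inl (Or.inr ⟨hL, h0, h1r, hlt, hp⟩)
    · rintro ((⟨hL, h0, h1r, hm, hp⟩ | ⟨hL, h0, h1r, hm, hp⟩) | ⟨⟨hL, h0, h1r⟩, hm, hp⟩)
      · exact ⟨hL, h0, h1r, by linarith, by linarith⟩
      · exact ⟨hL, h0, h1r, by linarith, hp⟩
      · exact ⟨hL, h0, h1r, hm, by linarith⟩
  have hd1 : Disjoint (lfunctionZeroBox χ t₀) A := by
    rw [Set.disjoint_left]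
    rintro ρ hρ ⟨-, -, -, hlt, -⟩
    have := (abs_le.1 (mem_lfunctionZeroBox.1 hρ).2.2.2).2
    linarith
  have hd2 : Disjoint (lfunctionZeroBox χ t₀ ∪ A) B := by
    rw [Set.disjoint_left]
    rintro ρ (hρ | ⟨-, -, -, hlt, -⟩) ⟨-, -, hlt'⟩
    · have := (abs_le.1 (mem_lfunctionZeroBox.1 hρ).2.2.2).1
      linarith
    · linarith
  rw [lfunctionZeroCount, hunion,
    finsum_mem_union hd2 ((hfin.subset hsub0).union (hfin.subset hsubA)) (hfin.subset hsubB),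
    finsum_mem_union hd1 (hfin.subset hsub0) (hfin.subset hsubA), lfunctionZeroCountIoc_inv_eq h1 t₀ t]
  rfl

/-- Additivity of the window count: `N(t₀, t₂] = N(t₀, t₁] + N(t₁, t₂]` for `t₀ ≤ t₁ ≤ t₂` (`χ ≠ 1`).
[folklore] -/
private theorem lfunctionZeroCountIoc_add (h1 : χ ≠ 1) {t₀ t₁ t₂ : ℝ} (h01 : t₀ ≤ t₁) (h12 : t₁ ≤ t₂) :
    lfunctionZeroCountIoc χ t₀ t₂ = lfunctionZeroCountIoc χ t₀ t₁ + lfunctionZeroCountIoc χ t₁ t₂ := by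
  set A : Set ℂ := {ρ : ℂ | χ.LFunction ρ = 0 ∧ 0 < ρ.re ∧ ρ.re < 1 ∧ t₀ < ρ.im ∧ ρ.im ≤ t₁} with hA
  set B : Set ℂ := {ρ : ℂ | χ.LFunction ρ = 0 ∧ 0 < ρ.re ∧ ρ.re < 1 ∧ t₁ < ρ.im ∧ ρ.im ≤ t₂} with hB
  have hfin : (lfunctionZeroBox χ (max |t₀| |t₂|)).Finite := lfunctionZeroBox_finite h1 _
  have hsub : {ρ : ℂ | χ.LFunction ρ = 0 ∧ 0 < ρ.re ∧ ρ.re < 1 ∧ t₀ < ρ.im ∧ ρ.im ≤ t₂} ⊆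
      lfunctionZeroBox χ (max |t₀| |t₂|) := fun ρ hρ ↦ by
    obtain ⟨hL, h0, h1r, ha, hb⟩ := hρ
    refine mem_lfunctionZeroBox.2 ⟨hL, h0, h1r, abs_le.2 ⟨?_, hb.trans (le_abs_self _) |>.trans (le_max_right _ _)⟩⟩
    have : -|t₀| ≤ t₀ := neg_abs_le t₀
    linarith [le_max_left |t₀| |t₂|]
  have hunion : {ρ : ℂ | χ.LFunction ρ = 0 ∧ 0 < ρ.re ∧ ρ.re < 1 ∧ t₀ < ρ.im ∧ ρ.im ≤ t₂} = A ∪ B := by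
    ext ρ
    simp only [mem_union, hA, hB, mem_setOf_eq]
    constructor
    · rintro ⟨hL, h0, h1r, ha, hb⟩
      rcases le_or_gt ρ.im t₁ with hle | hlt
      · exact Or.inl ⟨hL, h0, h1r, ha, hle⟩
      · exact Or.inr ⟨hL, h0, h1r, hlt, hb⟩
    · rintro (⟨hL, h0, h1r, ha, hb⟩ | ⟨hL, h0, h1r, ha, hb⟩)
      · exact ⟨hL, h0, h1r, ha, by linarith⟩
      · exact ⟨hL, h0, h1r, by linarith, hb⟩
  have hd : Disjoint A B := by
    rw [Set.disjoint_left]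
    rintro ρ ⟨-, -, -, -, hb⟩ ⟨-, -, -, ha, -⟩
    linarith
  have hsubA : A ⊆ lfunctionZeroBox χ (max |t₀| |t₂|) := fun ρ hρ ↦ hsub (hunion ▸ Or.inl hρ)
  have hsubB : B ⊆ lfunctionZeroBox χ (max |t₀| |t₂|) := fun ρ hρ ↦ hsub (hunion ▸ Or.inr hρ)
  rw [lfunctionZeroCountIoc, hunion, finsum_mem_union hd (hfin.subset hsubA) (hfin.subset hsubB)]
  rfl

/-- `t ↦ Ñ_{t₀,χ}(t)` is non-decreasing on `[t₀, ∞)` (`χ ≠ 1`). [folklore] -/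
private theorem monotoneOn_lfunctionZeroCountIoc (h1 : χ ≠ 1) (t₀ : ℝ) :
    MonotoneOn (fun t : ℝ ↦ (lfunctionZeroCountIoc χ t₀ t : ℝ)) (Ici t₀) := by
  intro t ht t' _ htt'
  have := lfunctionZeroCountIoc_add h1 (show t₀ ≤ t from ht) htt'
  simp only [this, Nat.cast_add, le_add_iff_nonneg_right, Nat.cast_nonneg]

/-- `θ'(·, χ)` is continuous. [folklore] -/
private theorem continuous_lfunctionThetaDeriv (χ : DirichletCharacter ℂ q) :
    Continuous (lfunctionThetaDeriv χ) := by
  have hcont : Continuous fun u : ℝ ↦ (logDeriv Gammaℝ (1 / 2 + (charParity χ : ℂ) + u * I)).re := by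
    refine Complex.continuous_re.comp (continuous_iff_continuousAt.2 fun u ↦ ?_)
    have hre : 0 < ((1 / 2 : ℂ) + (charParity χ : ℂ) + u * I).re := by
      simp
      positivity
    have hc : Continuous fun u : ℝ ↦ (1 / 2 : ℂ) + (charParity χ : ℂ) + u * I := by fun_prop
    exact (analyticAt_logDeriv_Gammaℝ hre).continuousAt.comp
      (f := fun u : ℝ ↦ (1 / 2 : ℂ) + (charParity χ : ℂ) + u * I) hc.continuousAt
  have hfun : lfunctionThetaDeriv χ =
      fun u : ℝ ↦ (logDeriv Gammaℝ (1 / 2 + (charParity χ : ℂ) + u * I)).re + Real.log q / 2 :=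
    funext (lfunctionThetaDeriv_eq χ)
  rw [hfun]
  exact hcont.add continuous_const

/-- **`θ(·, χ)` is continuous** (a primitive of the continuous `θ'`). [cite: Rumely1993ERH, §4 p. 426] -/
theorem continuous_lfunctionTheta (χ : DirichletCharacter ℂ q) : Continuous (lfunctionTheta χ) :=
  intervalIntegral.continuous_primitive
    (fun _ _ ↦ (continuous_lfunctionThetaDeriv χ).intervalIntegrable _ _) 0

/-- The ordinates `±γ` of the zeros in a box form a finite, hence null, set of heights. [folklore] -/
private theorem measure_ordinates_eq_zero (h1 : χ ≠ 1) (T : ℝ) :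
    volume ((fun ρ : ℂ ↦ ρ.im) '' lfunctionZeroBox χ T ∪ (fun ρ : ℂ ↦ -ρ.im) '' lfunctionZeroBox χ T) = 0 :=
  (((lfunctionZeroBox_finite h1 T).image _).union ((lfunctionZeroBox_finite h1 T).image _)).measure_zero _

/-- Off the finite set of heights `±γ` (`|γ| ≤ T`), a height `t` with `|t| ≤ T` is the ordinate of no
non-trivial zero, and neither is `−t`. [folklore] -/
private theorem forall_im_ne_of_not_mem (h1 : χ ≠ 1) {T t : ℝ} (htT : |t| ≤ T)
    (ht : t ∉ (fun ρ : ℂ ↦ ρ.im) '' lfunctionZeroBox χ T ∪ (fun ρ : ℂ ↦ -ρ.im) '' lfunctionZeroBox χ T) :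
    (∀ ρ ∈ charNontrivialZeros χ, ρ.im ≠ t) ∧ (∀ ρ ∈ charNontrivialZeros χ, ρ.im ≠ -t) := by
  have _ := h1
  simp only [mem_union, mem_image, not_or, not_exists, not_and] at ht
  refine ⟨fun ρ hρ h ↦ ht.1 ρ ?_ h, fun ρ hρ h ↦ ht.2 ρ ?_ (by rw [h, neg_neg])⟩
  · obtain ⟨hL, h0, h1r⟩ := mem_charNontrivialZeros.1 hρ
    exact mem_lfunctionZeroBox.2 ⟨hL, h0, h1r, by rw [h]; exact htT⟩
  · obtain ⟨hL, h0, h1r⟩ := mem_charNontrivialZeros.1 hρ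
    exact mem_lfunctionZeroBox.2 ⟨hL, h0, h1r, by rw [h, abs_neg]; exact htT⟩

/-- **`S(·, χ)` is integrable on `[t₀, t₀ + h]`** (`0 < t₀` the ordinate of no non-trivial zero,
primitive `χ`, `q > 1`): off the finitely many ordinates in between, Rumely's (3) exhibits `S(t, χ)` as
`Ñ_{t₀,χ}(t) − (θ(t, χ) − θ(t₀, χ))/π + S(t₀, χ)` — a monotone function minus a continuous one.
(The integrability that makes Turing's `∫_{t₀}^{t₀+h} S(t, χ) dt` meaningful.)
[cite: Platt2016GRH, Theorem 3.2] -/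
theorem intervalIntegrable_lfunctionArgS (hχ : χ.IsPrimitive) (hq : 1 < q) {t₀ h : ℝ} (ht₀ : 0 < t₀)
    (hh : 0 ≤ h) (hz : ∀ ρ ∈ charNontrivialZeros χ, ρ.im ≠ t₀) :
    IntervalIntegrable (lfunctionArgS χ) volume t₀ (t₀ + h) := by
  have hq1 : q ≠ 1 := by omega
  have h1 : χ ≠ 1 := SelbergDirichlet.ne_one_of_isPrimitive hq1 hχ
  set g : ℝ → ℝ := fun t ↦ (lfunctionZeroCountIoc χ t₀ t : ℝ) -
    (lfunctionTheta χ t - lfunctionTheta χ t₀) / π + lfunctionArgS χ t₀ with hg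
  have hle : t₀ ≤ t₀ + h := by linarith
  -- `g` is integrable: monotone + continuous + constant
  have hgi : IntervalIntegrable g volume t₀ (t₀ + h) := by
    refine ((MonotoneOn.intervalIntegrable ?_).sub ?_).add intervalIntegrable_const
    · rw [uIcc_of_le hle]
      exact (monotoneOn_lfunctionZeroCountIoc h1 t₀).mono Icc_subset_Ici_self
    · exact (((continuous_lfunctionTheta χ).sub continuous_const).div_const _).intervalIntegrable _ _
  -- `S = g` off the ordinates in `(t₀, t₀ + h]`
  have hae : ∀ᵐ t ∂volume, t ∈ uIoc t₀ (t₀ + h) → g t = lfunctionArgS χ t := by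
    have h0 := measure_eq_zero_iff_ae_notMem.1 (measure_ordinates_eq_zero h1 (t₀ + h))
    filter_upwards [h0] with t ht htmem
    rw [uIoc_of_le hle] at htmem
    have htT : |t| ≤ t₀ + h := abs_le.2 ⟨by linarith [htmem.1], htmem.2⟩
    have hne := (forall_im_ne_of_not_mem h1 htT ht).1
    have := lfunctionZeroCountIoc_eq hχ hq htmem.1 hz hne
    simp only [hg, this]
    ring
  exact hgi.congr_ae ((ae_restrict_iff' measurableSet_uIoc).2 hae)

/-- **Platt 2016, Theorem 3.2 (arXiv:1305.3087 §3, held text p. 5; journal Math. Comp. 85 p. 3014), in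
CORRECTED form — PROVED.** Platt prints, for a primitive `χ` of conductor `q`, `t₀, h > 0` with `t₀`, `t₀ + h`
ordinates of no zero, `N_χ(t₀)` = the number of zeros with `|ℑ s| ≤ t₀`, `ℜ s ∈ (0, 1)` (multiplicity)
and `Ñ_{t₀,χ}(t)` = the number of zeros with `ℑ s ∈ [t₀, t)`:
«`N_χ(t₀) = (1/(hπ))[2h + ((2ht₀ + h²)/2) log(q/π) + 2∫_{t₀}^{t₀+h} ℑ log Γ((1/2 + a_χ + it)/2) dt`
`− ∫Ñ_{t₀,χ} − ∫Ñ_{t₀,χ̄} + ∫S_χ + ∫S_χ̄]`» ("This is Theorem 3.1 [Booker] specialised to Dirichlet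
L-functions … we treat conjugate characters in pairs … Finally, we integrate both sides from `t₀` to
`t₀ + h`"). As printed this is NOT an identity (recorded by the parity-realchar cell, 2026-08-26): the
«`2h`» is the `ζ`-pole term «`+1`» of the `ζ`-count (Platt's thesis Thm. 2.5.1) carried over twice —
`Λ(s, χ)` is entire —, and the four integrals `∫Ñ`, `∫S` must not sit under the factor `1/π`. What the
stated derivation (Booker's theorem for the pair, integrated) actually gives, and what is proved here
in the tree's branch-free vocabulary (`θ(t, χ) = (t/2) log(q/π) + ℑ log Γ((½ + a_χ + it)/2)` by
continuous variation, so that `(1/π)[((2ht₀ + h²)/2) log(q/π) + 2∫ℑ log Γ] = (2/π)∫_{t₀}^{t₀+h} θ(t, χ) dt`),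
is

`h · N_χ(t₀) = (2/π) ∫_{t₀}^{t₀+h} θ(t, χ) dt + ∫_{t₀}^{t₀+h} S_χ + ∫_{t₀}^{t₀+h} S_χ̄`
`              − ∫_{t₀}^{t₀+h} Ñ_{t₀,χ} − ∫_{t₀}^{t₀+h} Ñ_{t₀,χ̄}`,

for `t₀ > 0`, `h ≥ 0`, `±t₀` ordinates of no non-trivial zero of `L(s, χ)` (equivalently `t₀` an
ordinate of neither `L_χ` nor `L_χ̄`; no hypothesis at `t₀ + h` is needed). Here `Ñ_{t₀,χ}(t)` is the
window count `t₀ < γ ≤ t` (`lfunctionZeroCountIoc χ t₀ t`, Booker's `N(t₀, t)`); Platt's `[t₀, t)`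
differs from it only at the (finitely many) ordinates `t`, which does not change the integrals.
Proof: the pointwise pair identity `lfunctionZeroCount_eq_theta_add_argS` and the exact count split
`lfunctionZeroCount_eq_add_Ioc` hold at every `t ∈ (t₀, t₀ + h]` off the finite set of heights `±γ`;
integrate (`S_χ`, `S_χ̄` are integrable by `intervalIntegrable_lfunctionArgS`, `Ñ` is monotone, `θ`
continuous). [cite: Platt2016GRH, Theorem 3.2] -/
theorem platt2016_theorem32_corrected (hχ : χ.IsPrimitive) (hq : 1 < q) {t₀ h : ℝ} (ht₀ : 0 < t₀)
    (hh : 0 ≤ h) (hz : ∀ ρ ∈ charNontrivialZeros χ, ρ.im ≠ t₀ ∧ ρ.im ≠ -t₀) :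
    h * (lfunctionZeroCount χ t₀ : ℝ) =
      2 / π * (∫ t in t₀..t₀ + h, lfunctionTheta χ t) +
        ((∫ t in t₀..t₀ + h, lfunctionArgS χ t) + ∫ t in t₀..t₀ + h, lfunctionArgS χ⁻¹ t) -
        ((∫ t in t₀..t₀ + h, (lfunctionZeroCountIoc χ t₀ t : ℝ)) +
          ∫ t in t₀..t₀ + h, (lfunctionZeroCountIoc χ⁻¹ t₀ t : ℝ)) := by
  have hq1 : q ≠ 1 := by omega
  have h1 : χ ≠ 1 := SelbergDirichlet.ne_one_of_isPrimitive hq1 hχ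
  have h1' : χ⁻¹ ≠ 1 := inv_ne_one.mpr h1
  have hχ' : χ⁻¹.IsPrimitive := isPrimitive_inv hχ
  have hle : t₀ ≤ t₀ + h := by linarith
  have hz₀ : ∀ ρ ∈ charNontrivialZeros χ, ρ.im ≠ t₀ := fun ρ hρ ↦ (hz ρ hρ).1
  have hz₀' : ∀ ρ ∈ charNontrivialZeros χ⁻¹, ρ.im ≠ t₀ :=
    forall_im_ne_inv h1 fun ρ hρ ↦ (hz ρ hρ).2
  -- integrability of the five integrands
  have iθ : IntervalIntegrable (lfunctionTheta χ) volume t₀ (t₀ + h) :=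
    (continuous_lfunctionTheta χ).intervalIntegrable _ _
  have iS : IntervalIntegrable (lfunctionArgS χ) volume t₀ (t₀ + h) :=
    intervalIntegrable_lfunctionArgS hχ hq ht₀ hh hz₀
  have iS' : IntervalIntegrable (lfunctionArgS χ⁻¹) volume t₀ (t₀ + h) :=
    intervalIntegrable_lfunctionArgS hχ' hq ht₀ hh hz₀'
  have iN : IntervalIntegrable (fun t ↦ (lfunctionZeroCountIoc χ t₀ t : ℝ)) volume t₀ (t₀ + h) := by
    refine MonotoneOn.intervalIntegrable ?_
    rw [uIcc_of_le hle]
    exact (monotoneOn_lfunctionZeroCountIoc h1 t₀).mono Icc_subset_Ici_self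
  have iN' : IntervalIntegrable (fun t ↦ (lfunctionZeroCountIoc χ⁻¹ t₀ t : ℝ)) volume t₀ (t₀ + h) := by
    refine MonotoneOn.intervalIntegrable ?_
    rw [uIcc_of_le hle]
    exact (monotoneOn_lfunctionZeroCountIoc h1' t₀).mono Icc_subset_Ici_self
  -- the pointwise identity off the (finitely many) ordinates
  have hae : ∀ᵐ t ∂volume, t ∈ uIoc t₀ (t₀ + h) →
      (lfunctionZeroCount χ t₀ : ℝ) =
        2 / π * lfunctionTheta χ t + (lfunctionArgS χ t + lfunctionArgS χ⁻¹ t) -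
          ((lfunctionZeroCountIoc χ t₀ t : ℝ) + (lfunctionZeroCountIoc χ⁻¹ t₀ t : ℝ)) := by
    have h0 := measure_eq_zero_iff_ae_notMem.1 (measure_ordinates_eq_zero h1 (t₀ + h))
    filter_upwards [h0] with t ht htmem
    rw [uIoc_of_le hle] at htmem
    have htT : |t| ≤ t₀ + h := abs_le.2 ⟨by linarith [htmem.1], htmem.2⟩
    obtain ⟨hp, hm⟩ := forall_im_ne_of_not_mem h1 htT ht
    have hcount := lfunctionZeroCount_eq_add_Ioc h1 ht₀.le htmem.1.le
    have hpt := lfunctionZeroCount_eq_theta_add_argS hχ hq (ht₀.trans htmem.1) hp hm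
    rw [hcount] at hpt
    push_cast at hpt
    linarith
  -- integrate over `[t₀, t₀ + h]`
  have hconst : ∫ _ in t₀..t₀ + h, (lfunctionZeroCount χ t₀ : ℝ) = h * (lfunctionZeroCount χ t₀ : ℝ) := by
    rw [intervalIntegral.integral_const, smul_eq_mul]
    ring
  rw [← hconst, intervalIntegral.integral_congr_ae hae,
    intervalIntegral.integral_sub ((iθ.const_mul _).add (iS.add iS')) (iN.add iN'),
    intervalIntegral.integral_add (iθ.const_mul _) (iS.add iS'), intervalIntegral.integral_add iS iS',
    intervalIntegral.integral_add iN iN', intervalIntegral.integral_const_mul]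

/-! ### Turing's method for the pair `χ, χ̄`, assembled (the Dirichlet twin of `TuringMethod.lean`) -/

/-- **Found zeros bound the window count from below**: `m` distinct ordinates `γ ∈ (t₀, t]` of
zeros of `L(s, χ)` on the critical line give `m ≤ Ñ_{t₀,χ}(t)` (`χ ≠ 1`; each zero has multiplicity
`≥ 1`). [cite: Platt2016GRH, Theorem 3.2] -/
theorem card_le_lfunctionZeroCountIoc (h1 : χ ≠ 1) {t₀ t : ℝ} (Z : Finset ℝ)
    (hZ : ∀ γ ∈ Z, χ.LFunction (1 / 2 + γ * I) = 0 ∧ t₀ < γ ∧ γ ≤ t) :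
    Z.card ≤ lfunctionZeroCountIoc χ t₀ t := by
  classical
  set W : Set ℂ := {ρ : ℂ | χ.LFunction ρ = 0 ∧ 0 < ρ.re ∧ ρ.re < 1 ∧ t₀ < ρ.im ∧ ρ.im ≤ t} with hW
  have hfin : W.Finite := zeroWindow_finite h1 t₀ t
  set f : ℝ → ℂ := fun γ ↦ 1 / 2 + γ * I with hf
  have hfinj : Function.Injective f := by
    intro a b hab
    have := congrArg Complex.im hab
    simpa [hf] using this
  have himg : Z.image f ⊆ hfin.toFinset := by
    intro ρ hρ
    rw [Finset.mem_image] at hρ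
    obtain ⟨γ, hγ, rfl⟩ := hρ
    rw [Set.Finite.mem_toFinset]
    obtain ⟨h0, ha, hb⟩ := hZ γ hγ
    exact ⟨h0, by simp [hf], by norm_num [hf], by simpa [hf] using ha, by simpa [hf] using hb⟩
  rw [lfunctionZeroCountIoc, finsum_mem_eq_finite_toFinset_sum _ hfin]
  calc Z.card = (Z.image f).card := (Finset.card_image_of_injective Z hfinj).symm
    _ = ∑ _ρ ∈ Z.image f, 1 := by simp
    _ ≤ ∑ ρ ∈ Z.image f, DirichletDisc.zeroOrder χ ρ := Finset.sum_le_sum fun ρ hρ ↦ by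
        have hρW := (Set.Finite.mem_toFinset hfin).1 (himg hρ)
        exact (DirichletDisc.zeroOrder_pos_iff χ h1 ρ).2 hρW.1
    _ ≤ ∑ ρ ∈ hfin.toFinset, DirichletDisc.zeroOrder χ ρ :=
        Finset.sum_le_sum_of_subset_of_nonneg himg fun _ _ _ ↦ Nat.zero_le _

/-- **Found zeros on the line bound the critical count from below**: `n` distinct ordinates
`γ`, `|γ| ≤ T`, of zeros of `L(s, χ)` on the critical line give `n ≤ N_{χ,0}(T)` (`χ ≠ 1`) — the lower
half of the count sandwich (`LFunctionRHUpTo.of_count_sandwich`). [cite: Platt2016GRH, §3] -/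
theorem card_le_lfunctionCriticalZeroCount (h1 : χ ≠ 1) {T : ℝ} (W : Finset ℝ)
    (hW : ∀ γ ∈ W, χ.LFunction (1 / 2 + γ * I) = 0 ∧ |γ| ≤ T) :
    W.card ≤ lfunctionCriticalZeroCount χ T := by
  classical
  set C : Set ℂ := {ρ ∈ lfunctionZeroBox χ T | ρ.re = 1 / 2} with hC
  have hfin : C.Finite := (lfunctionZeroBox_finite h1 T).subset (sep_subset _ _)
  set f : ℝ → ℂ := fun γ ↦ 1 / 2 + γ * I with hf
  have hfinj : Function.Injective f := by
    intro a b hab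
    have := congrArg Complex.im hab
    simpa [hf] using this
  have himg : W.image f ⊆ hfin.toFinset := by
    intro ρ hρ
    rw [Finset.mem_image] at hρ
    obtain ⟨γ, hγ, rfl⟩ := hρ
    rw [Set.Finite.mem_toFinset]
    obtain ⟨h0, habs⟩ := hW γ hγ
    exact ⟨mem_lfunctionZeroBox.2 ⟨h0, by simp [hf], by norm_num [hf], by simpa [hf] using habs⟩,
      by simp [hf]⟩
  rw [lfunctionCriticalZeroCount, finsum_mem_eq_finite_toFinset_sum _ hfin]
  calc W.card = (W.image f).card := (Finset.card_image_of_injective W hfinj).symm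
    _ = ∑ _ρ ∈ W.image f, 1 := by simp
    _ ≤ ∑ ρ ∈ W.image f, DirichletDisc.zeroOrder χ ρ := Finset.sum_le_sum fun ρ hρ ↦ by
        have hρC := (Set.Finite.mem_toFinset hfin).1 (himg hρ)
        exact (DirichletDisc.zeroOrder_pos_iff χ h1 ρ).2 (mem_lfunctionZeroBox.1 hρC.1).1
    _ ≤ ∑ ρ ∈ hfin.toFinset, DirichletDisc.zeroOrder χ ρ :=
        Finset.sum_le_sum_of_subset_of_nonneg himg fun _ _ _ ↦ Nat.zero_le _

/-- The step `t ↦ [γ < t]` is monotone. [folklore] -/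
private theorem monotone_ite_lt (γ : ℝ) : Monotone fun t : ℝ ↦ if γ < t then (1 : ℝ) else 0 := by
  intro x y hxy
  by_cases hx : γ < x
  · have hy : γ < y := hx.trans_le hxy
    simp [hx, hy]
  · by_cases hy : γ < y <;> simp [hx, hy]

/-- `∫_a^b [γ < t] dt = b − γ` for `a ≤ γ ≤ b`. [folklore] -/
private theorem integral_ite_lt {a b γ : ℝ} (ha : a ≤ γ) (hb : γ ≤ b) :
    ∫ t in a..b, (if γ < t then (1 : ℝ) else 0) = b - γ := by
  have hi : ∀ c d, IntervalIntegrable (fun t : ℝ ↦ if γ < t then (1 : ℝ) else 0) volume c d :=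
    fun c d ↦ (monotone_ite_lt γ).intervalIntegrable
  rw [← intervalIntegral.integral_add_adjacent_intervals (hi a γ) (hi γ b)]
  have h1 : ∫ t in a..γ, (if γ < t then (1 : ℝ) else 0) = ∫ _ in a..γ, (0 : ℝ) := by
    refine intervalIntegral.integral_congr fun t ht ↦ ?_
    rw [uIcc_of_le ha] at ht
    simp [not_lt.2 ht.2]
  have h2 : ∫ t in γ..b, (if γ < t then (1 : ℝ) else 0) = ∫ _ in γ..b, (1 : ℝ) := by
    refine intervalIntegral.integral_congr_ae (Filter.Eventually.of_forall fun t ht ↦ ?_)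
    rw [uIoc_of_le hb] at ht
    simp [ht.1]
  rw [h1, h2]
  simp

/-- `∫_{t₀}^{t₀+h} #{γ ∈ Z | γ < t} dt = Σ_{γ ∈ Z} (t₀ + h − γ)` when all `γ ∈ (t₀, t₀ + h]`. [folklore] -/
private theorem integral_card_filter_lt {t₀ h : ℝ} (Z : Finset ℝ) (hZ : ∀ γ ∈ Z, t₀ < γ ∧ γ ≤ t₀ + h) :
    ∫ t in t₀..t₀ + h, ((Z.filter (· < t)).card : ℝ) = ∑ γ ∈ Z, (t₀ + h - γ) := by
  simp_rw [Finset.natCast_card_filter]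
  rw [intervalIntegral.integral_finsetSum fun γ _ ↦ (monotone_ite_lt γ).intervalIntegrable]
  exact Finset.sum_congr rfl fun γ hγ ↦ integral_ite_lt (hZ γ hγ).1.le (hZ γ hγ).2

/-- The counting function `t ↦ #{γ ∈ Z | γ < t}` is monotone. [folklore] -/
private theorem monotone_card_filter_lt (Z : Finset ℝ) :
    Monotone fun t : ℝ ↦ ((Z.filter (· < t)).card : ℝ) := by
  intro x y hxy
  have hsub : Z.filter (· < x) ⊆ Z.filter (· < y) := fun γ hγ ↦ by
    rw [Finset.mem_filter] at hγ ⊢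
    exact ⟨hγ.1, hγ.2.trans_le hxy⟩
  have h := Finset.card_le_card hsub
  dsimp only
  exact_mod_cast h

/-- `Σ_{γ ∈ Z} (t₀ + h − γ) ≤ ∫_{t₀}^{t₀+h} Ñ_{t₀,χ}(t) dt` for found zeros `γ ∈ (t₀, t₀ + h]` of
`L(s, χ)` on the line. [folklore] -/
private theorem sum_le_integral_lfunctionZeroCountIoc (h1 : χ ≠ 1) {t₀ h : ℝ} (hh : 0 ≤ h)
    (Z : Finset ℝ) (hZ : ∀ γ ∈ Z, χ.LFunction (1 / 2 + γ * I) = 0 ∧ t₀ < γ ∧ γ ≤ t₀ + h) :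
    ∑ γ ∈ Z, (t₀ + h - γ) ≤ ∫ t in t₀..t₀ + h, (lfunctionZeroCountIoc χ t₀ t : ℝ) := by
  have hle : t₀ ≤ t₀ + h := by linarith
  rw [← integral_card_filter_lt Z fun γ hγ ↦ (hZ γ hγ).2]
  refine intervalIntegral.integral_mono_on hle (monotone_card_filter_lt Z).intervalIntegrable ?_
    fun t ht ↦ ?_
  · refine MonotoneOn.intervalIntegrable ?_
    rw [uIcc_of_le hle]
    exact (monotoneOn_lfunctionZeroCountIoc h1 t₀).mono Icc_subset_Ici_self
  · have h := card_le_lfunctionZeroCountIoc h1 (t₀ := t₀) (t := t) (Z.filter (· < t)) fun γ hγ ↦ by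
      rw [Finset.mem_filter] at hγ
      exact ⟨(hZ γ hγ.1).1, (hZ γ hγ.1).2.1, hγ.2.le⟩
    exact_mod_cast h

/-- **The Turing–Lehman inequality for a Dirichlet pair** (Edwards §8.2 for `ζ`; Booker 2006 §4 /
Platt 2016 §3 for `L(s, χ)`): for a primitive `χ` of conductor `q > 1`, `t₀ > 0` with `±t₀` ordinates
of no non-trivial zero, `h ≥ 0`, and finite sets `Z`, `Z'` of ordinates `γ ∈ (t₀, t₀ + h]` of zeros of
`L(s, χ)`, resp. `L(s, χ̄)`, on the critical line ("found zeros"),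
`h·N_χ(t₀) + Σ_{Z}(t₀ + h − γ) + Σ_{Z'}(t₀ + h − γ) − (2/π)∫_{t₀}^{t₀+h} θ(t, χ) dt ≤ ∫_{t₀}^{t₀+h} S_χ + ∫_{t₀}^{t₀+h} S_χ̄`
(from `platt2016_theorem32_corrected` and `Ñ_{t₀,χ}(t) ≥ #{γ ∈ Z : γ < t}`). [cite: Platt2016GRH, Theorem 3.2] -/
theorem turing_lehman_lower_bound (hχ : χ.IsPrimitive) (hq : 1 < q) {t₀ h : ℝ} (ht₀ : 0 < t₀)
    (hh : 0 ≤ h) (hz : ∀ ρ ∈ charNontrivialZeros χ, ρ.im ≠ t₀ ∧ ρ.im ≠ -t₀)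
    (Z : Finset ℝ) (hZ : ∀ γ ∈ Z, χ.LFunction (1 / 2 + γ * I) = 0 ∧ t₀ < γ ∧ γ ≤ t₀ + h)
    (Z' : Finset ℝ) (hZ' : ∀ γ ∈ Z', χ⁻¹.LFunction (1 / 2 + γ * I) = 0 ∧ t₀ < γ ∧ γ ≤ t₀ + h) :
    h * (lfunctionZeroCount χ t₀ : ℝ) + ∑ γ ∈ Z, (t₀ + h - γ) + ∑ γ ∈ Z', (t₀ + h - γ) -
        2 / π * ∫ t in t₀..t₀ + h, lfunctionTheta χ t ≤
      (∫ t in t₀..t₀ + h, lfunctionArgS χ t) + ∫ t in t₀..t₀ + h, lfunctionArgS χ⁻¹ t := by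
  have hq1 : q ≠ 1 := by omega
  have h1 : χ ≠ 1 := SelbergDirichlet.ne_one_of_isPrimitive hq1 hχ
  have h1' : χ⁻¹ ≠ 1 := inv_ne_one.mpr h1
  have hP := platt2016_theorem32_corrected hχ hq ht₀ hh hz
  have hN := sum_le_integral_lfunctionZeroCountIoc h1 hh Z hZ
  have hN' := sum_le_integral_lfunctionZeroCountIoc h1' hh Z' hZ'
  linarith

/-- **Turing's method for `L(s, χ)`** (pair form): in the setting of `turing_lehman_lower_bound`, if
`∫_{t₀}^{t₀+h} S_χ + ∫_{t₀}^{t₀+h} S_χ̄ ≤ B` and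
`B + (2/π)∫_{t₀}^{t₀+h} θ(t, χ) dt − Σ_{Z}(t₀ + h − γ) − Σ_{Z'}(t₀ + h − γ) < h(n + 1)`, then `N_χ(t₀) ≤ n`:
the zero count up to height `t₀` is certified from above by found zeros just above `t₀` and an explicit
bound for `∫ S` (Rumely's Theorem 2, Trudgian's, Booker's Theorem 4.6). [cite: Platt2016GRH, Theorem 3.2] -/
theorem lfunctionZeroCount_le_of_turing (hχ : χ.IsPrimitive) (hq : 1 < q) {t₀ h B : ℝ} {n : ℕ}
    (ht₀ : 0 < t₀) (hh : 0 ≤ h) (hz : ∀ ρ ∈ charNontrivialZeros χ, ρ.im ≠ t₀ ∧ ρ.im ≠ -t₀)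
    (Z : Finset ℝ) (hZ : ∀ γ ∈ Z, χ.LFunction (1 / 2 + γ * I) = 0 ∧ t₀ < γ ∧ γ ≤ t₀ + h)
    (Z' : Finset ℝ) (hZ' : ∀ γ ∈ Z', χ⁻¹.LFunction (1 / 2 + γ * I) = 0 ∧ t₀ < γ ∧ γ ≤ t₀ + h)
    (hS : (∫ t in t₀..t₀ + h, lfunctionArgS χ t) + ∫ t in t₀..t₀ + h, lfunctionArgS χ⁻¹ t ≤ B)
    (hnum : B + 2 / π * (∫ t in t₀..t₀ + h, lfunctionTheta χ t) - ∑ γ ∈ Z, (t₀ + h - γ) -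
        ∑ γ ∈ Z', (t₀ + h - γ) < h * (n + 1)) :
    lfunctionZeroCount χ t₀ ≤ n := by
  by_contra hlt
  rw [not_le] at hlt
  have h1 : (n : ℝ) + 1 ≤ lfunctionZeroCount χ t₀ := by exact_mod_cast Nat.succ_le_of_lt hlt
  have h2 : h * ((n : ℝ) + 1) ≤ h * lfunctionZeroCount χ t₀ := mul_le_mul_of_nonneg_left h1 hh
  have h3 := turing_lehman_lower_bound hχ hq ht₀ hh hz Z hZ Z' hZ'
  linarith

end TuringDirichlet

open TuringDirichlet in
/-- **A complete GRH-verification step for `L(s, χ)` (Turing's method assembled; Platt 2016 §3, §7).**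
Data, for a primitive `χ` of conductor `q > 1` and a height `t₀ > 0` with `±t₀` ordinates of no
non-trivial zero: (i) `n` distinct ordinates `γ`, `|γ| ≤ t₀`, of zeros of `L(s, χ)` on the critical
line (found below `t₀`, e.g. from sign changes of the completed function); (ii) found zeros `Z`, `Z'`
of `L(s, χ)`, `L(s, χ̄)` on the line with ordinates in `(t₀, t₀ + h]`, `h ≥ 0`; (iii) a bound
`∫_{t₀}^{t₀+h} S_χ + ∫_{t₀}^{t₀+h} S_χ̄ ≤ B` (Rumely 1993 Thm. 2 / Trudgian 2011 / Booker 2006 Thm. 4.6);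
(iv) the real inequality `B + (2/π)∫_{t₀}^{t₀+h} θ(t, χ) dt − Σ_Z(t₀ + h − γ) − Σ_{Z'}(t₀ + h − γ) < h(n + 1)`.
Conclusion: every zero of `L(s, χ)` with `0 < β < 1`, `|γ| ≤ t₀` lies on the critical line
(`LFunctionRHUpTo χ t₀`) and `N_χ(t₀) = N_{χ,0}(t₀) = n`. Everything but the certified zero data and
one explicit inequality is a theorem of the tree; the only named fact a user must supply is the bound
(iii). [cite: Platt2016GRH, §3 and §7] -/
theorem LFunctionRHUpTo.of_turing {χ : DirichletCharacter ℂ q} (hχ : χ.IsPrimitive) (hq : 1 < q)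
    {t₀ h B : ℝ} {n : ℕ} (ht₀ : 0 < t₀) (hh : 0 ≤ h)
    (hz : ∀ ρ ∈ charNontrivialZeros χ, ρ.im ≠ t₀ ∧ ρ.im ≠ -t₀)
    (W : Finset ℝ) (hW : ∀ γ ∈ W, χ.LFunction (1 / 2 + γ * I) = 0 ∧ |γ| ≤ t₀) (hWn : W.card = n)
    (Z : Finset ℝ) (hZ : ∀ γ ∈ Z, χ.LFunction (1 / 2 + γ * I) = 0 ∧ t₀ < γ ∧ γ ≤ t₀ + h)
    (Z' : Finset ℝ) (hZ' : ∀ γ ∈ Z', χ⁻¹.LFunction (1 / 2 + γ * I) = 0 ∧ t₀ < γ ∧ γ ≤ t₀ + h)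
    (hS : (∫ t in t₀..t₀ + h, lfunctionArgS χ t) + ∫ t in t₀..t₀ + h, lfunctionArgS χ⁻¹ t ≤ B)
    (hnum : B + 2 / π * (∫ t in t₀..t₀ + h, lfunctionTheta χ t) - ∑ γ ∈ Z, (t₀ + h - γ) -
        ∑ γ ∈ Z', (t₀ + h - γ) < h * (n + 1)) :
    LFunctionRHUpTo χ t₀ ∧ lfunctionZeroCount χ t₀ = n ∧ lfunctionCriticalZeroCount χ t₀ = n := by
  have hq1 : q ≠ 1 := by omega
  have h1 : χ ≠ 1 := SelbergDirichlet.ne_one_of_isPrimitive hq1 hχ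
  have hup : lfunctionZeroCount χ t₀ ≤ n :=
    lfunctionZeroCount_le_of_turing hχ hq ht₀ hh hz Z hZ Z' hZ' hS hnum
  have hlow : n ≤ lfunctionCriticalZeroCount χ t₀ := hWn ▸ card_le_lfunctionCriticalZeroCount h1 W hW
  exact LFunctionRHUpTo.of_count_sandwich h1 hup hlow

open TuringDirichlet in
/-- **Turing's method with Rumely's bound plugged in** (`t₀ > 50`): data (i), (ii), (iv) of
`LFunctionRHUpTo.of_turing` with `B = 2·(1.8397 + 0.1242 log(q(t₀ + h)/2π))` certify
`LFunctionRHUpTo χ t₀ ∧ N_χ(t₀) = N_{χ,0}(t₀) = n`, conditionally ONLY on the named fact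
`rumely1993_theorem2` (Rumely 1993 Thm. 2 = Platt 2016 Thm. 3.3) — the exact shape of Rumely's and
Platt's verifications: what remains unformalised is the bound for `∫ S` and the certified zero data.
[cite: Platt2016GRH, Theorem 3.3] -/
theorem LFunctionRHUpTo.of_turing_rumely (hR : rumely1993_theorem2) {χ : DirichletCharacter ℂ q}
    (hχ : χ.IsPrimitive) (hq : 1 < q) {t₀ h : ℝ} {n : ℕ} (ht₀ : 50 < t₀) (hh : 0 < h)
    (hz : ∀ ρ ∈ charNontrivialZeros χ, ρ.im ≠ t₀ ∧ ρ.im ≠ -t₀)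
    (W : Finset ℝ) (hW : ∀ γ ∈ W, χ.LFunction (1 / 2 + γ * I) = 0 ∧ |γ| ≤ t₀) (hWn : W.card = n)
    (Z : Finset ℝ) (hZ : ∀ γ ∈ Z, χ.LFunction (1 / 2 + γ * I) = 0 ∧ t₀ < γ ∧ γ ≤ t₀ + h)
    (Z' : Finset ℝ) (hZ' : ∀ γ ∈ Z', χ⁻¹.LFunction (1 / 2 + γ * I) = 0 ∧ t₀ < γ ∧ γ ≤ t₀ + h)
    (hnum : 2 * (1.8397 + 0.1242 * Real.log (q * (t₀ + h) / (2 * π))) +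
        2 / π * (∫ t in t₀..t₀ + h, lfunctionTheta χ t) - ∑ γ ∈ Z, (t₀ + h - γ) -
        ∑ γ ∈ Z', (t₀ + h - γ) < h * (n + 1)) :
    LFunctionRHUpTo χ t₀ ∧ lfunctionZeroCount χ t₀ = n ∧ lfunctionCriticalZeroCount χ t₀ = n := by
  have hS₁ := rumely1993_theorem2.integral_le hR hq hχ ht₀ hh
  have hS₂ := rumely1993_theorem2.integral_le hR hq (isPrimitive_inv hχ) ht₀ hh
  exact LFunctionRHUpTo.of_turing hχ hq (by linarith) hh.le hz W hW hWn Z hZ Z' hZ' (by linarith [hS₁, hS₂])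
    hnum

end Literature.NumberTheory.LFunctions

/-! ### Littlewood's theorem for Dirichlet `L`-series (Rumely 1993, Lemma 3; Booker 2006 §4):
### `π ∫_{t₁}^{t₂} S(t, χ) dt = ∫_{1/2}^∞ log|L(σ + it₂, χ)| dσ − ∫_{1/2}^∞ log|L(σ + it₁, χ)| dσ` -/

namespace Literature.NumberTheory.LFunctions

open DirichletTheta DirichletCharacter ExplicitPsiChar Literature.Analysis.Complex

variable {q : ℕ} [NeZero q] {χ : DirichletCharacter ℂ q}

namespace TuringDirichlet

/-- **`S(·, χ)` is integrable on `[t₀, t₀ + h]`** for EVERY real `t₀` that is the ordinate of no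
non-trivial zero (primitive `χ`, `q > 1`, `h ≥ 0`) — the version of
`intervalIntegrable_lfunctionArgS` without the restriction `t₀ > 0` (same proof, box of height
`max |t₀| |t₀ + h|`). [cite: Rumely1993ERH, Lemma 3 p. 429] -/
theorem intervalIntegrable_lfunctionArgS' (hχ : χ.IsPrimitive) (hq : 1 < q) {t₀ h : ℝ}
    (hh : 0 ≤ h) (hz : ∀ ρ ∈ charNontrivialZeros χ, ρ.im ≠ t₀) :
    IntervalIntegrable (lfunctionArgS χ) volume t₀ (t₀ + h) := by
  have hq1 : q ≠ 1 := by omega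
  have h1 : χ ≠ 1 := SelbergDirichlet.ne_one_of_isPrimitive hq1 hχ
  set g : ℝ → ℝ := fun t ↦ (lfunctionZeroCountIoc χ t₀ t : ℝ) -
    (lfunctionTheta χ t - lfunctionTheta χ t₀) / π + lfunctionArgS χ t₀ with hg
  have hle : t₀ ≤ t₀ + h := by linarith
  have hgi : IntervalIntegrable g volume t₀ (t₀ + h) := by
    refine ((MonotoneOn.intervalIntegrable ?_).sub ?_).add intervalIntegrable_const
    · rw [uIcc_of_le hle]
      exact (monotoneOn_lfunctionZeroCountIoc h1 t₀).mono Icc_subset_Ici_self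
    · exact (((continuous_lfunctionTheta χ).sub continuous_const).div_const _).intervalIntegrable _ _
  set T : ℝ := max |t₀| |t₀ + h| with hT
  have hae : ∀ᵐ t ∂volume, t ∈ uIoc t₀ (t₀ + h) → g t = lfunctionArgS χ t := by
    have h0 := measure_eq_zero_iff_ae_notMem.1 (measure_ordinates_eq_zero h1 T)
    filter_upwards [h0] with t ht htmem
    rw [uIoc_of_le hle] at htmem
    have htT : |t| ≤ T := abs_le_max_abs_abs htmem.1.le htmem.2
    have hne := (forall_im_ne_of_not_mem h1 htT ht).1
    have := lfunctionZeroCountIoc_eq hχ hq htmem.1 hz hne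
    simp only [hg, this]
    ring
  exact hgi.congr_ae ((ae_restrict_iff' measurableSet_uIoc).2 hae)

/-- `π S(t, χ) = −∫_{1/2}^∞ Im (L'/L)(σ + it, χ) dσ` — the definition of `lfunctionArgS`, rearranged.
[cite: Booker2006, §4 (4–1) p. 394] -/
theorem pi_mul_lfunctionArgS_eq (χ : DirichletCharacter ℂ q) (t : ℝ) :
    π * lfunctionArgS χ t = -∫ x in Ioi (1 / 2 : ℝ), (logDeriv χ.LFunction (x + t * I)).im := by
  have hπ : π ≠ 0 := Real.pi_ne_zero
  have hint : (∫ σ in Ioi (1 / 2 : ℝ),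
      (deriv χ.LFunction ((σ : ℂ) + (t : ℂ) * I) / χ.LFunction ((σ : ℂ) + (t : ℂ) * I)).im) =
      ∫ x in Ioi (1 / 2 : ℝ), (logDeriv χ.LFunction (x + t * I)).im := by
    refine setIntegral_congr_fun measurableSet_Ioi fun x _ ↦ ?_
    simp only [logDeriv_apply]
  rw [lfunctionArgS, hint]
  field_simp

/-- **Joint integrability of `Im L'/L(x + it, χ)` near the critical strip**, on
`[t₁, t₂] × (½, 2]` for `t₂ ≤ t₁ + 1/10` (`χ ≠ 1`): by the disc partial fraction
`L'/L(s, χ) = Σ_{disc} m(ρ)/(s − ρ) + O(ℒ)` (`DirichletDisc.exists_norm_logDeriv_sub_sum_le`, MV Lemma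
12.6, on `|s − (2 + it₀)| ≤ 38/25 ⊇ [½, 2] × [t₀ − 1/20, t₀ + 1/20]`) the integrand is dominated, off
the finitely many zeros, by `Cℒ + Σ m(ρ)/|s − ρ|`, and `1/|s − ρ|` is integrable in two dimensions
(`integrableOn_inv_norm_vertical_sub`). [folklore] -/
private theorem integrableOn_im_logDeriv_LFunction_near (h1 : χ ≠ 1) {t₁ t₂ : ℝ}
    (hlen : t₂ ≤ t₁ + 1 / 10) :
    IntegrableOn (fun p : ℝ × ℝ ↦ (logDeriv χ.LFunction (p.2 + p.1 * I)).im)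
      (Icc t₁ t₂ ×ˢ Ioc (1 / 2 : ℝ) 2) := by
  set R : Set (ℝ × ℝ) := Icc t₁ t₂ ×ˢ Ioc (1 / 2 : ℝ) 2 with hR
  set t₀ : ℝ := (t₁ + t₂) / 2 with ht₀
  set sp : ℝ × ℝ → ℂ := fun p ↦ (p.2 : ℂ) + p.1 * I with hsp
  have hRm : MeasurableSet R := measurableSet_Icc.prod measurableSet_Ioc
  have hRb : Bornology.IsBounded R := (Metric.isBounded_Icc _ _).prod (Metric.isBounded_Ioc _ _)
  have hball : ∀ p ∈ R, sp p ∈ Metric.closedBall (2 + (t₀ : ℂ) * I) (38 / 25) := by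
    rintro ⟨t, x⟩ ⟨ht, hx⟩
    refine DirichletDisc.mem_closedBall_of_re_mem_Icc ⟨hx.1.le, hx.2⟩ ?_
    rw [abs_le]
    simp only [ht₀]
    constructor <;> linarith [ht.1, ht.2]
  obtain ⟨C, hC0, hC⟩ := DirichletDisc.exists_norm_logDeriv_sub_sum_le
  set Z : Finset ℂ := DirichletDisc.discZeros χ t₀ with hZ
  set d : ℂ → ℤ := fun ρ ↦ DirichletDisc.discDivisor χ t₀ ρ with hd
  set ℒ : ℝ := Real.log q + Real.log (|t₀| + 4) with hℒ
  -- the dominating function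
  set G : ℝ × ℝ → ℝ := fun p ↦ C * ℒ + ∑ ρ ∈ Z, (d ρ : ℝ) * ‖sp p - ρ‖⁻¹ with hG
  have hGint : IntegrableOn G R := by
    have hfin : volume R < ⊤ := hRb.measure_lt_top
    refine ((integrableOn_const (C := C * ℒ) hfin.ne).add ?_)
    refine integrable_finsetSum _ fun ρ _ ↦ ?_
    exact (integrableOn_inv_norm_vertical_sub ρ hRb).const_mul _
  -- the exceptional (finite) set of zeros
  set E : Set (ℝ × ℝ) := (fun ρ : ℂ ↦ (ρ.im, ρ.re)) '' (Z : Set ℂ) with hE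
  have hEfin : E.Finite := (Z.finite_toSet).image _
  have hE0 : volume E = 0 := hEfin.measure_zero _
  have hzero_mem : ∀ p ∈ R, χ.LFunction (sp p) = 0 → p ∈ E := by
    rintro p hp h0'
    have hmem : sp p ∈ Z := by
      rw [hZ, DirichletDisc.mem_discZeros h1]
      exact ⟨Metric.closedBall_subset_closedBall (by norm_num) (hball p hp), h0'⟩
    refine ⟨sp p, hmem, ?_⟩
    simp [hsp]
  -- the pointwise bound off the zeros
  have hbound : ∀ p ∈ R, χ.LFunction (sp p) ≠ 0 → ‖(logDeriv χ.LFunction (sp p)).im‖ ≤ G p := by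
    intro p hp hL
    have h1' := hC q χ h1 t₀ (sp p) (hball p hp) hL
    rw [Real.norm_eq_abs]
    refine (abs_im_le_norm _).trans ?_
    have h4 : ‖∑ ρ ∈ Z, (DirichletDisc.discDivisor χ t₀ ρ : ℂ) / (sp p - ρ)‖ ≤
        ∑ ρ ∈ Z, (d ρ : ℝ) * ‖sp p - ρ‖⁻¹ := by
      refine (norm_sum_le _ _).trans (Finset.sum_le_sum fun ρ _ ↦ ?_)
      rw [norm_div, div_eq_mul_inv]
      gcongr
      have : (0 : ℤ) ≤ DirichletDisc.discDivisor χ t₀ ρ := DirichletDisc.discDivisor_nonneg h1 t₀ ρ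
      rw [Complex.norm_intCast, abs_of_nonneg (by exact_mod_cast this)]
    calc ‖logDeriv χ.LFunction (sp p)‖
        ≤ ‖logDeriv χ.LFunction (sp p) - ∑ ρ ∈ Z, (DirichletDisc.discDivisor χ t₀ ρ : ℂ) / (sp p - ρ)‖ +
          ‖∑ ρ ∈ Z, (DirichletDisc.discDivisor χ t₀ ρ : ℂ) / (sp p - ρ)‖ := by
          have := norm_add_le (logDeriv χ.LFunction (sp p) -
            ∑ ρ ∈ Z, (DirichletDisc.discDivisor χ t₀ ρ : ℂ) / (sp p - ρ))
            (∑ ρ ∈ Z, (DirichletDisc.discDivisor χ t₀ ρ : ℂ) / (sp p - ρ))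
          rw [sub_add_cancel] at this
          exact this
      _ ≤ C * ℒ + ∑ ρ ∈ Z, (d ρ : ℝ) * ‖sp p - ρ‖⁻¹ := by gcongr
      _ = G p := by rw [hG]
  -- measurability: continuity off the (null) exceptional set
  have hcont : ContinuousOn (fun p : ℝ × ℝ ↦ (logDeriv χ.LFunction (sp p)).im) (R \ E) := by
    intro p hp
    have hpR := hp.1
    have hL : χ.LFunction (sp p) ≠ 0 := fun h ↦ hp.2 (hzero_mem p hpR h)
    have hc : Continuous sp := by simp only [hsp]; fun_prop
    have h1' := (continuousAt_logDeriv_LFunction h1 hL).comp (f := sp) hc.continuousAt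
    exact (continuous_im.continuousAt.comp h1').continuousWithinAt
  have hae : R \ E =ᵐ[volume] R := sdiff_null_ae_eq_self hE0
  have hmeas : AEStronglyMeasurable
      (fun p : ℝ × ℝ ↦ (logDeriv χ.LFunction (sp p)).im) (volume.restrict R) := by
    rw [← Measure.restrict_congr_set hae]
    exact hcont.aestronglyMeasurable (hRm.diff hEfin.measurableSet)
  refine hGint.mono' hmeas ?_
  rw [ae_restrict_iff' hRm]
  have hnotE : ∀ᵐ p : ℝ × ℝ ∂volume, p ∉ E := compl_mem_ae_iff.2 hE0
  filter_upwards [hnotE] with p hpE hpR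
  exact hbound p hpR fun h ↦ hpE (hzero_mem p hpR h)

open scoped ArithmeticFunction.vonMangoldt in
/-- **Joint integrability of `Im L'/L(x + it, χ)` on `[t₁, t₂] × (2, ∞)`** (dominated by
`C · 2^{2−x}`). [folklore] -/
private theorem integrableOn_im_logDeriv_LFunction_far (h1 : χ ≠ 1) (t₁ t₂ : ℝ) :
    IntegrableOn (fun p : ℝ × ℝ ↦ (logDeriv χ.LFunction (p.2 + p.1 * I)).im)
      (Icc t₁ t₂ ×ˢ Ioi (2 : ℝ)) := by
  set R : Set (ℝ × ℝ) := Icc t₁ t₂ ×ˢ Ioi (2 : ℝ) with hR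
  set sp : ℝ × ℝ → ℂ := fun p ↦ (p.2 : ℂ) + p.1 * I with hsp
  set K : ℝ := ∑' n : ℕ, Λ n / (n : ℝ) ^ (2 : ℝ) with hK
  have hRm : MeasurableSet R := measurableSet_Icc.prod measurableSet_Ioi
  have hre2 : ∀ p ∈ R, 2 ≤ (sp p).re := fun p hp ↦ by simp [hsp]; exact le_of_lt hp.2
  have hL : ∀ p ∈ R, χ.LFunction (sp p) ≠ 0 := fun p hp ↦
    LFunction_ne_zero_of_one_le_re χ (Or.inl h1) (le_trans (by norm_num) (hre2 p hp))
  have hdom : Integrable (fun p : ℝ × ℝ ↦ (1 : ℝ) * (K * (4 * Real.exp (-Real.log 2 * p.2))))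
      ((volume.restrict (Icc t₁ t₂)).prod (volume.restrict (Ioi (2 : ℝ)))) := by
    have h1' : Integrable (fun _ : ℝ ↦ (1 : ℝ)) (volume.restrict (Icc t₁ t₂)) := integrable_const _
    have h2 : Integrable (fun x : ℝ ↦ K * (4 * Real.exp (-Real.log 2 * x)))
        (volume.restrict (Ioi (2 : ℝ))) :=
      (((exp_neg_integrableOn_Ioi 2 (Real.log_pos (by norm_num))).const_mul 4).const_mul K)
    exact h1'.mul_prod h2
  rw [Measure.prod_restrict, ← Measure.volume_eq_prod] at hdom
  have hcont : ContinuousOn (fun p : ℝ × ℝ ↦ (logDeriv χ.LFunction (sp p)).im) R := by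
    intro p hp
    have hc : Continuous sp := by simp only [hsp]; fun_prop
    have h1' := (continuousAt_logDeriv_LFunction h1 (hL p hp)).comp (f := sp) hc.continuousAt
    exact (continuous_im.continuousAt.comp h1').continuousWithinAt
  refine hdom.mono' (hcont.aestronglyMeasurable hRm) ?_
  rw [ae_restrict_iff' hRm]
  refine Eventually.of_forall fun p hp ↦ ?_
  have h := norm_logDeriv_LFunction_le_of_two_le_re χ (hre2 p hp)
  rw [Real.norm_eq_abs, one_mul]
  refine (abs_im_le_norm _).trans (h.trans (le_of_eq ?_))
  have hre : (sp p).re = p.2 := by simp [hsp]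
  rw [hre, Real.rpow_def_of_pos (by norm_num), hK]
  have : Real.log 2 * (2 - p.2) = 2 * Real.log 2 + -Real.log 2 * p.2 := by ring
  rw [this, Real.exp_add, show (2 : ℝ) * Real.log 2 = Real.log 4 by
    rw [show (4 : ℝ) = 2 ^ 2 by norm_num, Real.log_pow]; norm_num, Real.exp_log (by norm_num)]
  ring

/-- Joint integrability of `Im L'/L(x + it, χ)` on `[t₁, t₂] × (½, ∞)` for `t₂ ≤ t₁ + 1/10`
(`χ ≠ 1`). [folklore] -/
private theorem integrableOn_im_logDeriv_LFunction_strip (h1 : χ ≠ 1) {t₁ t₂ : ℝ}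
    (hlen : t₂ ≤ t₁ + 1 / 10) :
    IntegrableOn (fun p : ℝ × ℝ ↦ (logDeriv χ.LFunction (p.2 + p.1 * I)).im)
      (Icc t₁ t₂ ×ˢ Ioi (1 / 2 : ℝ)) := by
  rw [← Ioc_union_Ioi_eq_Ioi (show (1 / 2 : ℝ) ≤ 2 by norm_num), Set.prod_union]
  exact (integrableOn_im_logDeriv_LFunction_near h1 hlen).union
    (integrableOn_im_logDeriv_LFunction_far h1 t₁ t₂)

/-- **`σ ↦ log ‖L(σ + it, χ)‖` is integrable on `(½, ∞)`** when `t` is the ordinate of no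
non-trivial zero (`χ ≠ 1`): continuous on `[½, 3]`, and `|log ‖L‖| ≤ (3/2)‖L − 1‖ ≤ 4·2^{−σ}` beyond.
Rumely's "integrals … over the horizontal rays" are honest Lebesgue integrals.
[cite: Rumely1993ERH, Lemma 3 p. 429] -/
theorem integrableOn_log_norm_LFunction (h1 : χ ≠ 1) {t : ℝ}
    (ht : ∀ ρ ∈ charNontrivialZeros χ, ρ.im ≠ t) :
    IntegrableOn (fun x : ℝ ↦ Real.log ‖χ.LFunction (x + t * I)‖) (Ioi (1 / 2 : ℝ)) := by
  have hcontAt : ∀ x : ℝ, 1 / 2 ≤ x → ContinuousAt (fun x : ℝ ↦ Real.log ‖χ.LFunction (x + t * I)‖) x := by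
    intro x hx
    have hc : Continuous fun x : ℝ ↦ (x : ℂ) + t * I := by fun_prop
    have h1' : ContinuousAt (fun x : ℝ ↦ χ.LFunction (x + t * I)) x :=
      ((differentiable_LFunction h1).continuous.continuousAt).comp (f := fun x : ℝ ↦ (x : ℂ) + t * I)
        hc.continuousAt
    exact (h1'.norm).log (norm_ne_zero_iff.2 (LFunction_ne_zero_of_half_le h1 ht hx))
  -- near part: continuity on `[1/2, 3]`
  have hnear : IntegrableOn (fun x : ℝ ↦ Real.log ‖χ.LFunction (x + t * I)‖) (Ioc (1 / 2) 3) :=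
    ((ContinuousOn.integrableOn_compact isCompact_Icc) fun x hx ↦
      (hcontAt x hx.1).continuousWithinAt).mono_set Ioc_subset_Icc_self
  -- far part: domination by `4 e^{−(log 2) x}`
  have hfar : IntegrableOn (fun x : ℝ ↦ Real.log ‖χ.LFunction (x + t * I)‖) (Ioi 3) := by
    have hdom : IntegrableOn (fun x : ℝ ↦ 4 * Real.exp (-Real.log 2 * x)) (Ioi 3) :=
      (exp_neg_integrableOn_Ioi 3 (Real.log_pos (by norm_num))).const_mul 4
    have hcont3 : ContinuousOn (fun x : ℝ ↦ Real.log ‖χ.LFunction (x + t * I)‖) (Ioi 3) :=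
      fun x hx ↦ (hcontAt x (le_trans (by norm_num) (le_of_lt hx))).continuousWithinAt
    refine hdom.mono' (hcont3.aestronglyMeasurable measurableSet_Ioi) ?_
    rw [ae_restrict_iff' measurableSet_Ioi]
    refine Eventually.of_forall fun x hx ↦ ?_
    have hx3 : (3 : ℝ) < x := hx
    have hb := norm_LFunction_sub_one_le_of_two_le_re χ (s := x + t * I) (by simp; linarith)
    simp only [add_re, ofReal_re, mul_re, ofReal_im, I_re, mul_zero, I_im, mul_one, sub_self,
      add_zero] at hb
    have hpow : (2 : ℝ) ^ (2 - x) = 4 * Real.exp (-Real.log 2 * x) := by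
      rw [Real.rpow_def_of_pos (by norm_num)]
      have : Real.log 2 * (2 - x) = 2 * Real.log 2 + -Real.log 2 * x := by ring
      rw [this, Real.exp_add, show (2 : ℝ) * Real.log 2 = Real.log 4 by
        rw [show (4 : ℝ) = 2 ^ 2 by norm_num, Real.log_pow]; norm_num, Real.exp_log (by norm_num)]
    have hpow_le : (2 : ℝ) ^ (2 - x) ≤ 1 / 2 := by
      have : (2 : ℝ) ^ (2 - x) ≤ (2 : ℝ) ^ (-1 : ℝ) :=
        Real.rpow_le_rpow_of_exponent_le (by norm_num) (by linarith)
      rw [Real.rpow_neg_one] at this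
      linarith
    have hπ : π ^ 2 / 6 - 1 ≤ 0.65 := by
      have := Real.pi_lt_d4; nlinarith [Real.pi_pos]
    have hπ0 : 0 ≤ π ^ 2 / 6 - 1 := by
      have := Real.pi_gt_three; nlinarith
    have hsmall : ‖χ.LFunction (x + t * I) - 1‖ ≤ 1 / 2 := by
      refine hb.trans ?_
      calc (2 : ℝ) ^ (2 - x) * (π ^ 2 / 6 - 1) ≤ (1 / 2) * 0.65 := by gcongr
        _ ≤ 1 / 2 := by norm_num
    have hlog := abs_log_norm_le_of_norm_sub_one_le hsmall
    rw [Real.norm_eq_abs]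
    refine hlog.trans ?_
    have hexp0 : 0 ≤ Real.exp (-Real.log 2 * x) := (Real.exp_pos _).le
    calc 3 / 2 * ‖χ.LFunction (x + t * I) - 1‖ ≤ 3 / 2 * ((2 : ℝ) ^ (2 - x) * (π ^ 2 / 6 - 1)) := by
          gcongr
      _ ≤ 3 / 2 * ((2 : ℝ) ^ (2 - x) * 0.65) := by gcongr
      _ = 3 / 2 * (4 * Real.exp (-Real.log 2 * x) * 0.65) := by rw [hpow]
      _ ≤ 4 * Real.exp (-Real.log 2 * x) := by nlinarith
  rw [← Ioc_union_Ioi_eq_Ioi (show (1 / 2 : ℝ) ≤ 3 by norm_num)]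
  exact hnear.union hfar

/-- Almost every height `t ∈ [a, b]` is the ordinate of no non-trivial zero (`χ ≠ 1`: finitely many
zeros with `|γ| ≤ max |a| |b|`). [folklore] -/
private theorem ae_not_ordinate (h1 : χ ≠ 1) (a b : ℝ) :
    ∀ᵐ t : ℝ ∂volume, t ∈ Icc a b → ∀ ρ ∈ charNontrivialZeros χ, ρ.im ≠ t := by
  set T : ℝ := max |a| |b| with hT
  set Ords : Set ℝ := (fun ρ : ℂ ↦ ρ.im) '' lfunctionZeroBox χ T with hO
  have hfin : Ords.Finite := (lfunctionZeroBox_finite h1 T).image _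
  have hnot : ∀ᵐ t : ℝ ∂volume, t ∉ Ords := compl_mem_ae_iff.2 (hfin.measure_zero _)
  filter_upwards [hnot] with t ht hmem ρ hρ him
  apply ht
  obtain ⟨hL, h0, h1r⟩ := mem_charNontrivialZeros.1 hρ
  exact ⟨ρ, mem_lfunctionZeroBox.2 ⟨hL, h0, h1r, by rw [him]; exact abs_le_max_abs_abs hmem.1 hmem.2⟩,
    him⟩

/-- Off the finitely many abscissae of zeros with ordinate in `[a, b]`, the vertical segments
`{x} × [a, b]`, `x > ½`, carry no zero of `L(s, χ)` (`χ ≠ 1`): for a.e. `x`. [folklore] -/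
private theorem ae_no_zero_on_vertical (h1 : χ ≠ 1) (a b : ℝ) :
    ∀ᵐ x : ℝ ∂volume, ∀ t ∈ Icc a b, 1 / 2 < x → χ.LFunction (x + t * I) ≠ 0 := by
  set T : ℝ := max |a| |b| with hT
  set B : Set ℝ := (fun ρ : ℂ ↦ ρ.re) '' lfunctionZeroBox χ T with hB
  have hfin : B.Finite := (lfunctionZeroBox_finite h1 T).image _
  have hnot : ∀ᵐ x : ℝ ∂volume, x ∉ B := compl_mem_ae_iff.2 (hfin.measure_zero _)
  filter_upwards [hnot] with x hx t ht hx2 hL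
  rcases lt_or_ge x 1 with hx1 | hx1
  · apply hx
    refine ⟨x + t * I, mem_lfunctionZeroBox.2 ⟨hL, by simp; linarith, by simpa using hx1, ?_⟩, by simp⟩
    have him : ((x : ℂ) + t * I).im = t := by simp
    rw [him]
    exact abs_le_max_abs_abs ht.1 ht.2
  · exact LFunction_ne_zero_of_one_le_re χ (Or.inl h1) (by simpa using hx1) hL

/-- In every interval `(a, b)`, `a < b`, there is a height that is the ordinate of no non-trivial
zero (`χ ≠ 1`). [folklore] -/
private theorem exists_not_ordinate (h1 : χ ≠ 1) {a b : ℝ} (hab : a < b) :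
    ∃ t ∈ Ioo a b, ∀ ρ ∈ charNontrivialZeros χ, ρ.im ≠ t := by
  set T : ℝ := max |a| |b| with hT
  set Ords : Set ℝ := (fun ρ : ℂ ↦ ρ.im) '' lfunctionZeroBox χ T with hO
  have hfin : Ords.Finite := (lfunctionZeroBox_finite h1 T).image _
  obtain ⟨t, ht⟩ := ((Ioo_infinite hab).sdiff hfin).nonempty
  refine ⟨t, ht.1, fun ρ hρ him ↦ ht.2 ?_⟩
  obtain ⟨hL, h0, h1r⟩ := mem_charNontrivialZeros.1 hρ
  exact ⟨ρ, mem_lfunctionZeroBox.2 ⟨hL, h0, h1r, by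
    rw [him]; exact abs_le_max_abs_abs ht.1.1.le ht.1.2.le⟩, him⟩

/-- **Littlewood's theorem on a short range** (`t₁ ≤ t₂ ≤ t₁ + 1/10`, `t₁, t₂` ordinates of no
non-trivial zero; primitive `χ`, `q > 1`):
`π ∫_{t₁}^{t₂} S(t, χ) dt = ∫_{1/2}^∞ log ‖L(σ + it₂, χ)‖ dσ − ∫_{1/2}^∞ log ‖L(σ + it₁, χ)‖ dσ`.
Proof: integrate `π S(t, χ) = −∫_{1/2}^∞ Im L'/L(σ + it, χ) dσ` over `[t₁, t₂]`, exchange the integrals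
(Fubini, `integrableOn_im_logDeriv_LFunction_strip`) and integrate `−Im L'/L = ∂_t log ‖L‖` along a.e.
vertical ray (`integral_im_logDeriv_vertical`). [cite: Rumely1993ERH, Lemma 3 p. 429] -/
private theorem pi_mul_integral_lfunctionArgS_eq_of_short (hχ : χ.IsPrimitive) (hq : 1 < q)
    {t₁ t₂ : ℝ} (h12 : t₁ ≤ t₂) (hlen : t₂ ≤ t₁ + 1 / 10)
    (h1' : ∀ ρ ∈ charNontrivialZeros χ, ρ.im ≠ t₁) (h2' : ∀ ρ ∈ charNontrivialZeros χ, ρ.im ≠ t₂) :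
    π * ∫ t in t₁..t₂, lfunctionArgS χ t =
      (∫ x in Ioi (1 / 2 : ℝ), Real.log ‖χ.LFunction (x + t₂ * I)‖) -
        ∫ x in Ioi (1 / 2 : ℝ), Real.log ‖χ.LFunction (x + t₁ * I)‖ := by
  have hq1 : q ≠ 1 := by omega
  have h1 : χ ≠ 1 := SelbergDirichlet.ne_one_of_isPrimitive hq1 hχ
  set f : ℝ → ℝ → ℝ := fun t x ↦ (logDeriv χ.LFunction (x + t * I)).im with hf
  set L : ℝ → ℝ → ℝ := fun x t ↦ Real.log ‖χ.LFunction (x + t * I)‖ with hL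
  -- Step A: `π S(t) = −∫ f t` for every `t`
  have hA : ∫ t in t₁..t₂, π * lfunctionArgS χ t = ∫ t in t₁..t₂, -∫ x in Ioi (1 / 2 : ℝ), f t x :=
    intervalIntegral.integral_congr fun t _ ↦ pi_mul_lfunctionArgS_eq χ t
  -- Step B: Fubini
  have hint := integrableOn_im_logDeriv_LFunction_strip h1 hlen
  have hprod : Integrable (Function.uncurry f)
      ((volume.restrict (Icc t₁ t₂)).prod (volume.restrict (Ioi (1 / 2 : ℝ)))) := by
    rw [Measure.prod_restrict, ← Measure.volume_eq_prod]
    exact hint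
  have hB : ∫ t in t₁..t₂, (∫ x in Ioi (1 / 2 : ℝ), f t x) =
      ∫ x in Ioi (1 / 2 : ℝ), ∫ t in t₁..t₂, f t x := by
    rw [intervalIntegral.integral_of_le h12, ← integral_Icc_eq_integral_Ioc,
      integral_integral_swap hprod]
    refine integral_congr_ae (Eventually.of_forall fun x ↦ ?_)
    simp only
    rw [intervalIntegral.integral_of_le h12, ← integral_Icc_eq_integral_Ioc]
  -- Step C: the inner integrals, a.e. in `x`
  have hC : ∀ᵐ x : ℝ ∂(volume.restrict (Ioi (1 / 2 : ℝ))),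
      ∫ t in t₁..t₂, f t x = -(L x t₂ - L x t₁) := by
    rw [ae_restrict_iff' measurableSet_Ioi]
    filter_upwards [ae_no_zero_on_vertical h1 t₁ t₂] with x hx hx2
    have h := integral_im_logDeriv_vertical (g := χ.LFunction) (x := x) h12
      (fun t _ ↦ (differentiable_LFunction h1).analyticAt _) (fun t ht ↦ hx t ht hx2)
    simp only [hf, hL, logDeriv_apply]
    exact h
  have hC' : ∫ x in Ioi (1 / 2 : ℝ), (∫ t in t₁..t₂, f t x) =
      ∫ x in Ioi (1 / 2 : ℝ), -(L x t₂ - L x t₁) := integral_congr_ae hC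
  have hL1 := integrableOn_log_norm_LFunction h1 h1'
  have hL2 := integrableOn_log_norm_LFunction h1 h2'
  -- Step D
  rw [← intervalIntegral.integral_const_mul, hA, intervalIntegral.integral_neg, hB, hC',
    MeasureTheory.integral_neg, neg_neg]
  simp only [hL]
  exact integral_sub hL2 hL1

/-- **Rumely 1993, Lemma 3 (Littlewood's theorem for Dirichlet `L`-series) — PROVED.** «If `t₁, t₂`
are not the ordinates of zeros of `L(s, χ)`, then, writing `s = σ + it`, one has
`∫_{t₁}^{t₂} S(t, χ) dt = (1/π)∫_{1/2+it₂}^{+∞+it₂} ln|L(s, χ)| dσ − (1/π)∫_{1/2+it₁}^{+∞+it₁} ln|L(s, χ)| dσ`,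
where the integrals are taken over the horizontal rays indicated» (Rumely: «the proof is the same as
that for `ζ(s)`», Edwards pp. 190–192; Booker 2006 §4: «obtained by Littlewood's box principle»,
the starting point of his Theorem 4.6). Typed with `π` multiplied through, for a primitive `χ` of
conductor `q > 1` and real `t₁ ≤ t₂` ordinates of no non-trivial zero (the short-range case chained
across intermediate non-ordinates, which are dense). This is the identity on which every explicit
bound for `∫ S(t, χ) dt` rests (`rumely1993_theorem2`, `booker2006_theorem46_dirichlet`, Trudgian 2011):
it remains to bound `∫ log|L|` above along `Im s = t₂` and below along `Im s = t₁`.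
[cite: Rumely1993ERH, Lemma 3 p. 429] -/
theorem pi_mul_integral_lfunctionArgS_eq (hχ : χ.IsPrimitive) (hq : 1 < q) {t₁ t₂ : ℝ}
    (h12 : t₁ ≤ t₂) (h1' : ∀ ρ ∈ charNontrivialZeros χ, ρ.im ≠ t₁)
    (h2' : ∀ ρ ∈ charNontrivialZeros χ, ρ.im ≠ t₂) :
    π * ∫ t in t₁..t₂, lfunctionArgS χ t =
      (∫ x in Ioi (1 / 2 : ℝ), Real.log ‖χ.LFunction (x + t₂ * I)‖) -
        ∫ x in Ioi (1 / 2 : ℝ), Real.log ‖χ.LFunction (x + t₁ * I)‖ := by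
  have hq1 : q ≠ 1 := by omega
  have h1 : χ ≠ 1 := SelbergDirichlet.ne_one_of_isPrimitive hq1 hχ
  -- induction on the length, in steps of `1/20`
  suffices key : ∀ N : ℕ, ∀ t₁ t₂ : ℝ, t₁ ≤ t₂ → t₂ - t₁ ≤ N / 20 →
      (∀ ρ ∈ charNontrivialZeros χ, ρ.im ≠ t₁) → (∀ ρ ∈ charNontrivialZeros χ, ρ.im ≠ t₂) →
      π * ∫ t in t₁..t₂, lfunctionArgS χ t =
        (∫ x in Ioi (1 / 2 : ℝ), Real.log ‖χ.LFunction (x + t₂ * I)‖) -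
          ∫ x in Ioi (1 / 2 : ℝ), Real.log ‖χ.LFunction (x + t₁ * I)‖ by
    obtain ⟨N, hN⟩ := exists_nat_ge (20 * (t₂ - t₁))
    exact key N t₁ t₂ h12 (by linarith) h1' h2'
  intro N
  induction N with
  | zero =>
    intro t₁ t₂ h12 hlen h1' h2'
    exact pi_mul_integral_lfunctionArgS_eq_of_short hχ hq h12 (by simp at hlen; linarith) h1' h2'
  | succ N ih =>
    intro t₁ t₂ h12 hlen h1' h2'
    by_cases hshort : t₂ ≤ t₁ + 1 / 10
    · exact pi_mul_integral_lfunctionArgS_eq_of_short hχ hq h12 hshort h1' h2'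
    · rw [not_le] at hshort
      obtain ⟨t', ht', hord'⟩ := exists_not_ordinate h1 (a := t₁ + 1 / 20) (b := t₁ + 1 / 10)
        (by linarith)
      have hA := pi_mul_integral_lfunctionArgS_eq_of_short hχ hq (by linarith [ht'.1])
        (by linarith [ht'.2]) h1' hord'
      have hB := ih t' t₂ (by linarith [ht'.2]) (by push_cast at hlen ⊢; linarith [ht'.1]) hord' h2'
      have hS₁ : IntervalIntegrable (lfunctionArgS χ) volume t₁ t' := by
        have := intervalIntegrable_lfunctionArgS' hχ hq (t₀ := t₁) (h := t' - t₁)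
          (by linarith [ht'.1]) h1'
        simpa using this
      have hS₂ : IntervalIntegrable (lfunctionArgS χ) volume t' t₂ := by
        have := intervalIntegrable_lfunctionArgS' hχ hq (t₀ := t') (h := t₂ - t')
          (by linarith [ht'.2]) hord'
        simpa using this
      rw [← intervalIntegral.integral_add_adjacent_intervals hS₁ hS₂, mul_add, hA, hB]
      ring

end TuringDirichlet

end Literature.NumberTheory.LFunctions

end
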